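import Literature.NumberTheory.Sieve.HeathBrownCubicUpperBound
import Literature.NumberTheory.LFunctions.MertensSecondLogPower
import Literature.NumberTheory.LFunctions.IdealCountProofs
import Mathlib.NumberTheory.Harmonic.Bounds
import Mathlib.Analysis.PSeries
import Mathlib.Analysis.SpecialFunctions.Pow.Asymptotics
import HarnessLib

/-!
# Tools for the applications of Heath-Brown's Lemma 7.1 (§7 of Acta Math. 186 (2001))

Companion of `HeathBrownCubicUpperBound` (tenth layer of the decomposition of **parity.S18** along
Heath-Brown, *Primes represented by `x³ + 2y³`*, Acta Math. 186 (2001), 1–84), which vendors the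
upper-bound sieve lemma **Lemma 7.1** (p. 39) as the named fact `HeathBrown2001_lemma_7_1`. §7 of the
paper (pp. 41–47) deduces Lemma 3.6 and Lemma 3.7 from Lemma 7.1 by a handful of elementary devices
that are used "repeatedly" (p. 42): dyadic summation of Lemma 7.1 over a range of norms, Mertens-type
estimates for `∑ 1/N(P)` over windows ((7.1), (7.2)), the observation that for `𝒜^(K)` only moduli of
square-free norm built from first-degree primes occur (Lemma 3.1), and for `ℬ^(K)` the crude count
`#ℬ^(K)_R ≪ X³/N(R)` to dispose of prime ideals of degree `≥ 2` (p. 41). This file PROVES these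
tools on the objects of `HeathBrownCubicSieveSetup`/`HeathBrownCubicSieveDecomposition`; the file
`HeathBrownCubicUpperBoundProofs` assembles them into **Lemma 3.6 ⇐ Lemma 7.1** (pp. 41–42).

Everything in this file is PROVED. Contents:

* Sifting-function inequalities for a family `(E, I)`: `S_K^≺(𝒵_R, P) ≤ S_K(𝒵_R, z) ≤ #𝒵_R`
  for `z ≤ N(P)` (`famSiftedAbove_le_famSifted`, `famSifted_le_famCount`; `famCount E I R = #𝒵_R`).
* Lemma 3.1 consequences for `𝒜^(K)`: `#𝒜^(K)_P = 0` unless `N(P)` is prime, and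
  `#𝒜^(K)_{R} = 0` when two distinct prime factors of `R` have the same norm
  (`countA_eq_zero_of_not_prime`, `countA_eq_zero_of_absNorm_eq`; from
  `Literature.NumberTheory.LFunctions.CubeRootTwoField.prime_absNorm_of_mem`/`eq_of_mem_of_absNorm_eq`).
* **`#ℬ^(K)_R ≤ C_ℬ X³/N(R)`** for all nonzero `R`, `X ≥ 0`, `0 ≤ η ≤ 1` (`exists_countB_le`), from the
  Weber–Landau ideal count with error term proved in the tree
  (`Literature.NumberTheory.LFunctions.NumberField.idealCount_sub_residue_mul_le_holds`); this is the form of (5.7) used on p. 41.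
* At most `3 = [K:ℚ]` prime ideals of `𝓞_K` have a given norm
  (`card_filter_isPrime_absNorm_eq_le_three`, via `Literature.DegreeOnePrimes`), whence sums over prime
  ideals of prime norm are at most `3×` the corresponding sums over rational primes
  (`sum_primes_le_three_mul_sum_image`).
* **Mertens over windows**: `∑_{lo < p ≤ hi} 1/p ≤ (log(hi/lo) + K₁)/log lo` for `2 ≤ lo ≤ hi`
  (`exists_sum_primes_inv_window_le`, from the tree's Mertens theorem with a log-power error term,
  `Literature.NumberTheory.LFunctions.Mertens.abs_sum_primesLE_inv_sub_loglog_le`); harmonic and `∑ 1/n²` tail bounds.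
* **Dyadic summation of Lemma 7.1** (`dyadic_sum_le`): if a non-negative function `S` on ideals
  satisfies the conclusion of Lemma 7.1 for every block `(N, 2N]`, `N ≤ X^{2−2τ}`, then for a finite set
  `𝒬` of square-free integers in `[a, b)`, `2 ≤ a`, `b ≤ X^{2−2τ}`,
  `∑_{N(Q) ∈ 𝒬} S(Q) ≤ C (M/log min(z, X^{2−τ}/b)) ∑_{q∈𝒬} 1/q + (log b/log 2 + 1)·C·Err`
  (blocks indexed by `dyadIdx q = ⌊log₂(q−1)⌋`).
* **The parameters** (`eventually_upperBound_params`): with `τ = (log log X)^{−ϖ}`, `0 < ϖ ≤ 1`,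
  eventually `X ≥ 16`, `0 < τ ≤ 1/8`, `1/log X ≤ τ` and `A X^{−τ/5}(log X)^k ≤ τe^{−2(log X)^{1/3}}/log X`
  — the absorption of the terms `X^{2−τ/5}`, `X^{3−τ/5}` of Lemma 7.1 into `τη²X²/log X` for `η` in
  the range (2.1) ("by (2.1) and (2.5)", p. 41).
* **Single-prime ranges** (the shape of `S₃`, `S₅`, p. 41): for `X^{1/2} ≤ a ≤ b ≤ X^{2−2τ}` with
  `min(X^{1/2}, X^{2−τ}/b) ≥ X^{1/4}`,
  `∑_{a ≤ N(P) < b} S_K^≺(𝒜^(K)_P, P) ≤ C(η²X²/log X^{1/4}) ∑_{a≤p<b} 1/p + (log b/log 2 + 1) C X^{2−τ/5}`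
  (`primeRangeSum_boxPairs_le`) and the `ℬ^(K)` analogue with the extra term `3(√b + 1)·C_ℬX³/a` for
  the prime ideals of degree `≥ 2` (`primeRangeSum_normWindow_le`; "We no longer know that `N(P)` is
  prime. The contribution from prime ideals `P` of degree 2, however, is `≪ ∑ #ℬ(P_K) ≪ ∑ X³/N(P)`",
  p. 41).
* **`U`-pieces** (the shape of `S₆`, `S₇`, p. 41): an index `(s, P_{n+1})` of `U^(n)` ((3.1)) is sent
  to the ideal `uIdeal (s, P_{n+1}) = (∏_{P∈s} P)·P_{n+1}`, injectively (`uIdeal_injOn`, unique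
  factorisation); it is *good* (`UGood`) when all `N(P_i)` are prime and pairwise distinct, in which
  case `N(P_1⋯P_{n+1})` is square-free (`squarefree_absNorm_uIdeal`); for `𝒜^(K)` only good indices
  contribute (`countA_uIdeal_eq_zero_of_not_good`, `sum_filter_UGood_boxPairs`); the good part of a
  `U`-piece is bounded by Lemma 7.1 summed dyadically (`sum_good_le`), the bad part of a `ℬ^(K)`-piece
  by `C_ℬX³ ∑_{bad} 1/N(P_1⋯P_{n+1})` (`sum_filter_not_UGood_normWindow_le`).
* **Reciprocal sums over prime ideals**: `∑_{N(P) ≤ x} 1/N(P) ≤ 3(1 + log x)`,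
  `∑_{Y ≤ N(P), N(P) ∉ ℙ} 1/N(P) ≤ 6Y^{−1/3}`, `∑_{N(P) = N(P') ≥ Y, P ≠ P'} 1/N(P) N(P') ≤ 18/Y`, and the
  window bound `∑_{lo < N(P) ≤ hi, N(P) ∈ ℙ} 1/N(P) ≤ 3(log(hi/lo) + K₁)/log lo`
  (`sum_inv_absNorm_le`, `sum_inv_absNorm_nonprime_le`, `sum_inv_absNorm_pair_eq_le`,
  `sum_inv_absNorm_window_le`).

## References

* D. R. Heath-Brown, *Primes represented by `x³ + 2y³`*, Acta Math. 186 (2001), 1–84: Lemma 3.1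
  (p. 11), Lemma 7.1 (p. 39), §7 pp. 41–42 (the deduction of Lemma 3.6; (7.1), (7.2)).
  [cite: HeathBrownActa2001, §7 pp. 41–42]
* G. Harman, *Prime-Detecting Sieves*, LMS Monographs 33, Princeton (2007), §13.2.
  [cite: Harman2007, §13.2]
-/

noncomputable section

open Polynomial NumberField Finset Filter Topology Asymptotics
open scoped nonZeroDivisors

namespace Literature.NumberTheory.Sieve.CubicSieve

open LFunctions.CubeRootTwoField CubicPrimes


/-! ### Generic inequalities between the sifting functions of a family -/

section Family

variable {ι : Type*} (E : Finset ι) (I : ι → Ideal (𝓞 K))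

open scoped Classical in
/-- `#𝒵_R`, the number of members of the family divisible by `R`. [cite: HeathBrownActa2001, §3 p. 11] -/
def famCount (R : Ideal (𝓞 K)) : ℕ := #{i ∈ E | R ∣ I i}

/-- `S_K(𝒵_R, z) ≤ #𝒵_R`. [folklore] -/
theorem famSifted_le_famCount (R : Ideal (𝓞 K)) (z : ℝ) : famSifted E I R z ≤ famCount E I R := by
  classical
  unfold famSifted famCount
  exact card_le_card (monotone_filter_right _ fun i _ hi => hi.1)

/-- `S_K^≺(𝒵_R, P) ≤ S_K(𝒵_R, z)` for `z ≤ N(P)`: a member none of whose prime factors precedes `P`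
has all its prime factors of norm `≥ N(P) ≥ z`. [folklore] -/
theorem famSiftedAbove_le_famSifted (R P : Ideal (𝓞 K)) {z : ℝ} (hz : z ≤ Ideal.absNorm P) :
    famSiftedAbove E I R P ≤ famSifted E I R z := by
  classical
  unfold famSiftedAbove famSifted
  refine card_le_card (monotone_filter_right _ fun i _ hi => ⟨hi.1, fun Q hQ hQI => ?_⟩)
  rcases not_primeLT_iff.mp (hi.2 hQ hQI) with h' | h'
  · exact hz.trans (by exact_mod_cast h'.absNorm_le)
  · rw [h']; exact hz

/-- `S_K^≺(𝒵_R, P) ≤ #𝒵_R`. [folklore] -/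
theorem famSiftedAbove_le_famCount (R P : Ideal (𝓞 K)) : famSiftedAbove E I R P ≤ famCount E I R := by
  classical
  unfold famSiftedAbove famCount
  exact card_le_card (monotone_filter_right _ fun i _ hi => hi.1)

end Family

/-- `#𝒜^(K)_R` is the family count of `(boxPairs, pairIdeal)`. [folklore] -/
theorem famCount_boxPairs (X η : ℝ) (R : Ideal (𝓞 K)) :
    famCount (boxPairs X η) pairIdeal R = countA X η R := by
  classical
  rw [famCount, countA, APairs]

/-- `#ℬ^(K)_R` is the family count of the norm window. [folklore] -/
theorem famCount_normWindow (X η : ℝ) (R : Ideal (𝓞 K)) :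
    famCount (normWindow X η) (fun J => J) R = countB X η R := by
  classical
  rw [famCount, countB, BIdeals]

/-! ### Lemma 3.1 consequences: which `R` have `𝒜^(K)_R ≠ ∅` -/

/-- If a nonzero prime `P` of non-prime norm divides `R`, then `𝒜^(K)_R = ∅` (Lemma 3.1: only
first-degree primes divide `x + y·2^{1/3}`, `(x, y) = 1`). [cite: HeathBrownActa2001, Lemma 3.1] -/
theorem countA_eq_zero_of_not_prime {X η : ℝ} {R P : Ideal (𝓞 K)} (hP : P.IsPrime) (hP0 : P ≠ ⊥)
    (hPR : P ∣ R) (hnp : ¬ (Ideal.absNorm P).Prime) : countA X η R = 0 := by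
  classical
  rw [countA, card_eq_zero, eq_empty_iff_forall_notMem]
  intro xy hxy
  rw [mem_APairs_iff, mem_boxPairs_iff] at hxy
  obtain ⟨⟨-, -, -, -, hcop⟩, hR⟩ := hxy
  exact hnp (prime_absNorm_of_mem (Nat.isCoprime_iff_coprime.mpr hcop) hP hP0
    (intCast_mem_of_dvd_pairIdeal (hPR.trans hR)))

/-- If two distinct nonzero primes of equal norm divide `R`, then `𝒜^(K)_R = ∅` (Lemma 3.1).
[cite: HeathBrownActa2001, Lemma 3.1] -/
theorem countA_eq_zero_of_absNorm_eq {X η : ℝ} {R P P' : Ideal (𝓞 K)} (hP : P.IsPrime) (hP0 : P ≠ ⊥)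
    (hP' : P'.IsPrime) (hne : P ≠ P') (hN : Ideal.absNorm P = Ideal.absNorm P')
    (hPR : P ∣ R) (hP'R : P' ∣ R) : countA X η R = 0 := by
  classical
  rw [countA, card_eq_zero, eq_empty_iff_forall_notMem]
  intro xy hxy
  rw [mem_APairs_iff, mem_boxPairs_iff] at hxy
  obtain ⟨⟨-, -, -, -, hcop⟩, hR⟩ := hxy
  exact hne (eq_of_mem_of_absNorm_eq (Nat.isCoprime_iff_coprime.mpr hcop) hP hP0 hP'.ne_top
    (intCast_mem_of_dvd_pairIdeal (hPR.trans hR)) (intCast_mem_of_dvd_pairIdeal (hP'R.trans hR)) hN)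

/-! ### Counting the members of `ℬ^(K)_R`: `#ℬ^(K)_R ≪ X³/N(R)` (Weber–Landau) -/

/-- The number of ideals of norm `≤ m` is the Weber–Landau count of nonzero ideals plus one (the
zero ideal). [folklore] -/
theorem card_idealsLE_eq (m : ℕ) :
    (#(idealsLE m) : ℝ) = Literature.NumberTheory.LFunctions.NumberField.idealCount K m + 1 := by
  classical
  have h1 : #(idealsLE m) = Nat.card {I : Ideal (𝓞 K) // Ideal.absNorm I ≤ m} := by
    rw [idealsLE, ← Set.ncard_eq_toFinset_card _ (Ideal.finite_setOf_absNorm_le m),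
      ← Nat.card_coe_set_eq]
    rfl
  have h2 : Literature.NumberTheory.LFunctions.NumberField.idealCount K (m : ℝ) =
      Nat.card {I : (Ideal (𝓞 K))⁰ // Ideal.absNorm (I : Ideal (𝓞 K)) ≤ m} := by
    unfold Literature.NumberTheory.LFunctions.NumberField.idealCount
    simp_rw [Nat.cast_le]
  rw [h1, h2, Ideal.card_norm_le_eq_card_norm_le_add_one]
  push_cast
  ring

/-- **`#ℬ^(K)_R ≤ C_ℬ X³/N(R)`** for every nonzero `R`, `X ≥ 0`, `0 ≤ η ≤ 1`: the members of `ℬ^(K)_R`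
are `R·J'` with `N(J') ≤ 3X³(1+η)/N(R)`, and there are `≤ (ρ_K + C)t + 1` ideals of norm `≤ t`
(`t ≥ 1`) by the Weber–Landau count `I_K(t) = ρ_K t + O(t^{2/3})`
(`Literature.NumberTheory.LFunctions.NumberField.idealCount_sub_residue_mul_le_holds`). Heath-Brown uses the sharper
`#ℬ^(K)_P ≪ X³/N(P)` form of (5.7) on p. 41. [cite: HeathBrownActa2001, §7 p. 41] -/
theorem exists_countB_le :
    ∃ C : ℝ, 0 < C ∧ ∀ X η : ℝ, 0 ≤ X → 0 ≤ η → η ≤ 1 → ∀ R : Ideal (𝓞 K), R ≠ ⊥ →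
      (countB X η R : ℝ) ≤ C * X ^ 3 / Ideal.absNorm R := by
  classical
  obtain ⟨C₀, hC₀⟩ := Literature.NumberTheory.LFunctions.NumberField.idealCount_sub_residue_mul_le_holds K
  set ρ : ℝ := NumberField.dedekindZeta_residue K with hρ
  have hρ0 : 0 < ρ := NumberField.dedekindZeta_residue_pos K
  -- `C₀ ≥ 0` (take `x = 1`)
  have hC₀0 : 0 ≤ C₀ := by
    have h := hC₀ 1 le_rfl
    simp only [Real.one_rpow, mul_one] at h
    exact (abs_nonneg _).trans h
  -- `I_K(t) ≤ (ρ + C₀) t` for `t ≥ 1`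
  have hIK : ∀ t : ℝ, 1 ≤ t → (Literature.NumberTheory.LFunctions.NumberField.idealCount K t : ℝ) ≤ (ρ + C₀) * t := by
    intro t ht
    have h := hC₀ t ht
    have ht0 : 0 < t := by linarith
    have hpow : t ^ (1 - 1 / (Module.finrank ℚ K : ℝ)) ≤ t := by
      calc t ^ (1 - 1 / (Module.finrank ℚ K : ℝ)) ≤ t ^ (1 : ℝ) := by
            refine Real.rpow_le_rpow_of_exponent_le ht ?_
            have : (0 : ℝ) ≤ 1 / (Module.finrank ℚ K : ℝ) := by positivity
            linarith
        _ = t := Real.rpow_one t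
    have h' := (abs_le.mp h).2
    nlinarith [mul_le_mul_of_nonneg_left hpow hC₀0]
  refine ⟨6 * (ρ + C₀ + 1), by positivity, fun X η hX hη0 hη1 R hR0 => ?_⟩
  have hNR : 0 < (Ideal.absNorm R : ℝ) := by
    have : Ideal.absNorm R ≠ 0 := fun h => hR0 (Ideal.absNorm_eq_zero_iff.mp h)
    positivity
  set t : ℝ := 3 * X ^ 3 * (1 + η) / Ideal.absNorm R with ht
  have ht0 : 0 ≤ t := by rw [ht]; positivity
  have hX3 : 0 ≤ X ^ 3 := pow_nonneg hX 3
  -- the target bound dominates `(ρ + C₀ + 1) t`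
  have ht6 : t ≤ 6 * X ^ 3 / Ideal.absNorm R := by
    rw [ht]
    exact div_le_div_of_nonneg_right (by nlinarith) hNR.le
  have hdom : (ρ + C₀ + 1) * t ≤ 6 * (ρ + C₀ + 1) * X ^ 3 / Ideal.absNorm R := by
    have h0 : 0 ≤ ρ + C₀ + 1 := by positivity
    calc (ρ + C₀ + 1) * t ≤ (ρ + C₀ + 1) * (6 * X ^ 3 / Ideal.absNorm R) :=
          mul_le_mul_of_nonneg_left ht6 h0
      _ = 6 * (ρ + C₀ + 1) * X ^ 3 / Ideal.absNorm R := by ring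
  refine le_trans ?_ hdom
  by_cases hcase : 3 * X ^ 3 * (1 + η) < Ideal.absNorm R
  · -- no member of the window is divisible by `R`
    have h0 : countB X η R = 0 := by
      rw [countB, card_eq_zero, eq_empty_iff_forall_notMem]
      intro J hJ
      rw [mem_BIdeals_iff] at hJ
      obtain ⟨hJw, hRJ⟩ := hJ
      have hJ0 : J ≠ ⊥ := ne_bot_of_mem_normWindow hX J hJw
      rw [mem_normWindow_iff] at hJw
      obtain ⟨-, hJ2⟩ := hJw
      have hle : (Ideal.absNorm R : ℝ) ≤ Ideal.absNorm J := by
        exact_mod_cast Nat.le_of_dvd (Nat.pos_of_ne_zero fun h => hJ0 (Ideal.absNorm_eq_zero_iff.mp h))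
          (Ideal.absNorm_dvd_absNorm_of_le (Ideal.le_of_dvd hRJ))
      linarith
    rw [h0, Nat.cast_zero]
    positivity
  · push Not at hcase
    have ht1 : 1 ≤ t := by rwa [ht, le_div_iff₀ hNR, one_mul]
    -- `ℬ^(K)_R ⊆ R · {J' : N(J') ≤ t}`
    set m : ℕ := ⌊t⌋₊ with hm
    have hsub : BIdeals X η R ⊆ (idealsLE m).image fun J' => R * J' := by
      intro J hJ
      rw [mem_BIdeals_iff, mem_normWindow_iff] at hJ
      obtain ⟨⟨-, hJ2⟩, hRJ⟩ := hJ
      obtain ⟨J', rfl⟩ := hRJ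
      refine mem_image.mpr ⟨J', ?_, rfl⟩
      rw [mem_idealsLE, hm]
      refine Nat.le_floor ?_
      rw [ht, le_div_iff₀ hNR]
      have : (Ideal.absNorm (R * J') : ℝ) = Ideal.absNorm R * Ideal.absNorm J' := by
        rw [map_mul, Nat.cast_mul]
      nlinarith
    calc (countB X η R : ℝ) ≤ #((idealsLE m).image fun J' => R * J') := by
          rw [countB]; exact_mod_cast card_le_card hsub
      _ ≤ #(idealsLE m) := by exact_mod_cast card_image_le
      _ = Literature.NumberTheory.LFunctions.NumberField.idealCount K m + 1 := card_idealsLE_eq m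
      _ ≤ (ρ + C₀) * m + 1 := by
          have hm1 : (1 : ℝ) ≤ m := by
            rw [hm]; exact_mod_cast Nat.le_floor (by rw [Nat.cast_one]; exact ht1)
          linarith [hIK m hm1]
      _ ≤ (ρ + C₀) * t + t := by
          have hmt : (m : ℝ) ≤ t := Nat.floor_le ht0
          have : 0 ≤ ρ + C₀ := by positivity
          nlinarith
      _ = (ρ + C₀ + 1) * t := by ring

/-! ### Prime ideals with a given norm: at most `3` -/

/-- Every nonzero prime `P` of `𝓞_K` has norm `q^f` with `q` the rational prime below it and
`1 ≤ f ≤ 3`. [folklore] -/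
theorem exists_absNorm_eq_prime_pow_le_three {P : Ideal (𝓞 K)} (hP : P.IsPrime) (hP0 : P ≠ ⊥) :
    ∃ q f : ℕ, q.Prime ∧ 0 < f ∧ f ≤ 3 ∧ Ideal.absNorm P = q ^ f ∧
      P ∈ (Ideal.span {(q : ℤ)}).primesOver (𝓞 K) := by
  obtain ⟨q, f, hq, hf, hN, hover⟩ := exists_absNorm_eq_prime_pow hP hP0
  refine ⟨q, f, hq, hf, ?_, hN, hover⟩
  have hqP : (q : 𝓞 K) ∈ P := by
    have h := Ideal.absNorm_mem P
    rw [hN, Nat.cast_pow] at h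
    exact hP.mem_of_pow_mem _ h
  have hdvd : Ideal.absNorm P ∣ q ^ Module.finrank ℚ K := by
    rw [← Literature.NumberTheory.LFunctions.IdealNormCount.absNorm_span_natCast K q]
    exact Ideal.absNorm_dvd_absNorm_of_le ((Ideal.span_singleton_le_iff_mem _).2 hqP)
  rw [hN, finrank_K] at hdvd
  exact (Nat.pow_dvd_pow_iff_le_right hq.one_lt).mp hdvd

open scoped Classical in
/-- At most `3 = [K:ℚ]` nonzero prime ideals of `𝓞_K` have a given norm `n` (they all lie over the
least prime factor of `n`). [folklore] -/
theorem card_filter_isPrime_absNorm_eq_le_three (S : Finset (Ideal (𝓞 K))) (n : ℕ) :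
    #(S.filter fun P => P.IsPrime ∧ P ≠ ⊥ ∧ Ideal.absNorm P = n) ≤ 3 := by
  classical
  set T := S.filter fun P => P.IsPrime ∧ P ≠ ⊥ ∧ Ideal.absNorm P = n with hT
  by_cases hn : ∃ P, P ∈ T
  · obtain ⟨P₀, hP₀⟩ := hn
    obtain ⟨hP₀p, hP₀0, hP₀n⟩ := (mem_filter.mp hP₀).2
    obtain ⟨q, f, hq, hf, -, hN, -⟩ := exists_absNorm_eq_prime_pow_le_three hP₀p hP₀0
    have hmin : n.minFac = q := by rw [← hP₀n, hN, hq.pow_minFac (by omega)]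
    have hsub : ((T : Finset (Ideal (𝓞 K))) : Set (Ideal (𝓞 K))) ⊆
        (Ideal.span {(q : ℤ)}).primesOver (𝓞 K) := by
      intro P hP
      rw [Finset.mem_coe] at hP
      obtain ⟨hPp, hP0', hPn⟩ := (mem_filter.mp hP).2
      obtain ⟨q', f', hq', hf', -, hN', hover'⟩ := exists_absNorm_eq_prime_pow_le_three hPp hP0'
      have : q' = q := by
        rw [← hmin, ← hPn, hN', hq'.pow_minFac (by omega)]
      subst this
      exact hover'
    haveI := Fact.mk hq
    haveI : (Ideal.span {(q : ℤ)}).IsMaximal := Int.ideal_span_isMaximal_of_prime q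
    have hfin : ((Ideal.span {(q : ℤ)}).primesOver (𝓞 K)).Finite :=
      IsDedekindDomain.primesOver_finite _ _
    calc #T = ((T : Finset (Ideal (𝓞 K))) : Set (Ideal (𝓞 K))).ncard := by rw [Set.ncard_coe_finset]
      _ ≤ ((Ideal.span {(q : ℤ)}).primesOver (𝓞 K)).ncard := Set.ncard_le_ncard hsub hfin
      _ = Nat.card ((Ideal.span {(q : ℤ)}).primesOver (𝓞 K)) := (Nat.card_coe_set_eq _).symm
      _ ≤ Module.finrank ℚ K := Literature.NumberTheory.LFunctions.IdealNormCount.card_primesOver_le K hq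
      _ = 3 := finrank_K
  · push Not at hn
    rw [Finset.eq_empty_of_forall_notMem hn, card_empty]
    exact Nat.zero_le _

/-- Sums over prime ideals of a function of the norm are at most `3` times the corresponding sums
over the norms: `∑_{P ∈ 𝒮} g(N P) ≤ 3 ∑_{n ∈ N(𝒮)} g(n)` for `g ≥ 0` and `𝒮` a set of nonzero
primes. [folklore] -/
theorem sum_primes_le_three_mul_sum_image (S : Finset (Ideal (𝓞 K)))
    (hS : ∀ P ∈ S, P.IsPrime ∧ P ≠ ⊥) {g : ℕ → ℝ} (hg : ∀ n, 0 ≤ g n) :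
    ∑ P ∈ S, g (Ideal.absNorm P) ≤ 3 * ∑ n ∈ S.image Ideal.absNorm, g n := by
  classical
  rw [← sum_fiberwise_of_maps_to (g := Ideal.absNorm) (fun P hP => mem_image_of_mem _ hP), mul_sum]
  refine sum_le_sum fun n hn => ?_
  have hcard : #(S.filter fun P => Ideal.absNorm P = n) ≤ 3 := by
    have : S.filter (fun P => Ideal.absNorm P = n) =
        S.filter fun P => P.IsPrime ∧ P ≠ ⊥ ∧ Ideal.absNorm P = n :=
      filter_congr fun P hP => ⟨fun h => ⟨(hS P hP).1, (hS P hP).2, h⟩, fun h => h.2.2⟩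
    rw [this]
    exact card_filter_isPrime_absNorm_eq_le_three S n
  calc ∑ P ∈ S.filter (fun P => Ideal.absNorm P = n), g (Ideal.absNorm P)
      = ∑ P ∈ S.filter (fun P => Ideal.absNorm P = n), g n :=
        sum_congr rfl fun P hP => by rw [(mem_filter.mp hP).2]
    _ = #(S.filter fun P => Ideal.absNorm P = n) * g n := by rw [sum_const, nsmul_eq_mul]
    _ ≤ 3 * g n := by
        have : (#(S.filter fun P => Ideal.absNorm P = n) : ℝ) ≤ 3 := by exact_mod_cast hcard
        exact mul_le_mul_of_nonneg_right this (hg n)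

/-! ### Mertens: sums of `1/p` over windows `(lo, hi]` -/

/-- **Window sums of `1/p`** from Mertens' second theorem with error `O(1/log x)`
(`Literature.NumberTheory.LFunctions.Mertens.abs_sum_primesLE_inv_sub_loglog_le`): there is `K₁ ≥ 0` such that for all
`2 ≤ lo ≤ hi` and every set `T` of primes contained in `(lo, hi]`,
`∑_{p ∈ T} 1/p ≤ (log(hi/lo) + K₁)/log lo` (using `log(log hi/log lo) ≤ log(hi/lo)/log lo`).
[cite: MontgomeryVaughan2007, Thm 2.7 (d)] -/
theorem exists_sum_primes_inv_window_le :
    ∃ K₁ : ℝ, 0 ≤ K₁ ∧ ∀ (lo hi : ℝ) (T : Finset ℕ), 2 ≤ lo → lo ≤ hi →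
      (∀ p ∈ T, p.Prime ∧ lo < (p : ℝ) ∧ (p : ℝ) ≤ hi) →
      ∑ p ∈ T, (p : ℝ)⁻¹ ≤ (Real.log (hi / lo) + K₁) / Real.log lo := by
  classical
  obtain ⟨K, hK⟩ := Literature.NumberTheory.LFunctions.Mertens.abs_sum_primesLE_inv_sub_loglog_le 1
  have hK0 : 0 ≤ K := by
    have h := hK 2 le_rfl
    have hl2 : 0 < Real.log 2 := Real.log_pos one_lt_two
    rw [pow_one] at h
    by_contra hneg
    have : K / Real.log 2 < 0 := div_neg_of_neg_of_pos (not_le.mp hneg) hl2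
    linarith [abs_nonneg ((∑ p ∈ Nat.primesLE ⌊(2 : ℝ)⌋₊, (p : ℝ)⁻¹) -
      (Real.log (Real.log 2) + Literature.NumberTheory.LFunctions.Mertens.meisselMertens))]
  refine ⟨2 * K, by positivity, fun lo hi T hlo hlohi hT => ?_⟩
  set S : ℝ → ℝ := fun x => ∑ p ∈ Nat.primesLE ⌊x⌋₊, (p : ℝ)⁻¹ with hSdef
  have hlo1 : 1 < lo := by linarith
  have hllo : 0 < Real.log lo := Real.log_pos hlo1
  have hlhi : Real.log lo ≤ Real.log hi := Real.log_le_log (by linarith) hlohi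
  have hlhi0 : 0 < Real.log hi := hllo.trans_le hlhi
  -- `T ⊆ primesLE ⌊hi⌋ \ primesLE ⌊lo⌋`
  have hTsub : T ⊆ Nat.primesLE ⌊hi⌋₊ \ Nat.primesLE ⌊lo⌋₊ := by
    intro p hp
    obtain ⟨hpp, hplo, hphi⟩ := hT p hp
    refine Finset.mem_sdiff.mpr ⟨Nat.mem_primesLE.mpr ⟨Nat.le_floor hphi, hpp⟩, fun h => ?_⟩
    have : (p : ℝ) ≤ lo := (Nat.le_floor_iff (by linarith)).mp (Nat.mem_primesLE.mp h).1
    linarith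
  have hsub' : Nat.primesLE ⌊lo⌋₊ ⊆ Nat.primesLE ⌊hi⌋₊ := by
    intro p hp
    rw [Nat.mem_primesLE] at hp ⊢
    exact ⟨hp.1.trans (Nat.floor_le_floor hlohi), hp.2⟩
  have hwin : ∑ p ∈ T, (p : ℝ)⁻¹ ≤ S hi - S lo := by
    calc ∑ p ∈ T, (p : ℝ)⁻¹ ≤ ∑ p ∈ Nat.primesLE ⌊hi⌋₊ \ Nat.primesLE ⌊lo⌋₊, (p : ℝ)⁻¹ :=
          sum_le_sum_of_subset_of_nonneg hTsub fun p _ _ => by positivity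
      _ = S hi - S lo := by
          rw [hSdef]
          simp only
          rw [sum_sdiff_eq_sub hsub']
  have h1 := abs_le.mp (hK hi (hlo.trans hlohi))
  have h2 := abs_le.mp (hK lo hlo)
  rw [pow_one] at h1 h2
  -- `log log hi − log log lo ≤ log(hi/lo)/log lo`
  have hll : Real.log (Real.log hi) - Real.log (Real.log lo) ≤ Real.log (hi / lo) / Real.log lo := by
    rw [← Real.log_div hlhi0.ne' hllo.ne', Real.log_div (x := hi) (y := lo) (by linarith) (by linarith)]
    have h := Real.log_le_sub_one_of_pos (div_pos hlhi0 hllo)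
    calc Real.log (Real.log hi / Real.log lo) ≤ Real.log hi / Real.log lo - 1 := h
      _ = (Real.log hi - Real.log lo) / Real.log lo := by field_simp
  have hKhi : K / Real.log hi ≤ K / Real.log lo := div_le_div_of_nonneg_left hK0 hllo hlhi
  calc ∑ p ∈ T, (p : ℝ)⁻¹ ≤ S hi - S lo := hwin
    _ ≤ (Real.log (Real.log hi) + Literature.NumberTheory.LFunctions.Mertens.meisselMertens + K / Real.log hi) -
          (Real.log (Real.log lo) + Literature.NumberTheory.LFunctions.Mertens.meisselMertens - K / Real.log lo) := by
        have e1 : S hi ≤ Real.log (Real.log hi) + Literature.NumberTheory.LFunctions.Mertens.meisselMertens + K / Real.log hi := by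
          have := h1.2; rw [hSdef]; linarith
        have e2 : Real.log (Real.log lo) + Literature.NumberTheory.LFunctions.Mertens.meisselMertens - K / Real.log lo ≤ S lo := by
          have := h2.1; rw [hSdef]; linarith
        linarith
    _ ≤ Real.log (hi / lo) / Real.log lo + 2 * K / Real.log lo := by
        rw [mul_div_assoc]; linarith
    _ = (Real.log (hi / lo) + 2 * K) / Real.log lo := by rw [add_div]

/-- Harmonic bound `∑_{n ∈ T} 1/n ≤ 1 + log x` for `T ⊆ [1, x]`, `x ≥ 1`. [folklore] -/
theorem sum_inv_le_one_add_log {x : ℝ} (hx : 1 ≤ x) (T : Finset ℕ)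
    (hT : ∀ n ∈ T, 1 ≤ n ∧ (n : ℝ) ≤ x) : ∑ n ∈ T, (n : ℝ)⁻¹ ≤ 1 + Real.log x := by
  have hsub : T ⊆ Icc 1 ⌊x⌋₊ := fun n hn => mem_Icc.mpr ⟨(hT n hn).1, Nat.le_floor (hT n hn).2⟩
  have hx0 : 0 < x := by linarith
  calc ∑ n ∈ T, (n : ℝ)⁻¹ ≤ ∑ n ∈ Icc 1 ⌊x⌋₊, (n : ℝ)⁻¹ :=
        sum_le_sum_of_subset_of_nonneg hsub fun n _ _ => by positivity
    _ = ((harmonic ⌊x⌋₊ : ℚ) : ℝ) := by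
        rw [harmonic_eq_sum_Icc]; push_cast; rfl
    _ ≤ 1 + Real.log ⌊x⌋₊ := harmonic_le_one_add_log _
    _ ≤ 1 + Real.log x := by
        gcongr
        · exact_mod_cast Nat.floor_pos.mpr hx
        · exact Nat.floor_le hx0.le

/-- Tail of `∑ 1/n²`: `∑_{n ∈ T} 1/n² ≤ 2/y` for `T` a set of integers `> y ≥ 2`. [folklore] -/
theorem sum_inv_sq_tail_le {y : ℝ} (hy : 2 ≤ y) (T : Finset ℕ) (hT : ∀ n ∈ T, y < (n : ℝ)) :
    ∑ n ∈ T, ((n : ℝ) ^ 2)⁻¹ ≤ 2 / y := by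
  classical
  set k : ℕ := ⌊y⌋₊ with hk
  have hy0 : 0 ≤ y := by linarith
  have hk2 : 2 ≤ k := by
    rw [hk]; exact Nat.le_floor (by exact_mod_cast hy)
  have hk0 : k ≠ 0 := by omega
  have hkpos : (0 : ℝ) < k := by exact_mod_cast (show 0 < k by omega)
  have hk1 : (1 : ℝ) ≤ k := by exact_mod_cast (show 1 ≤ k by omega)
  have hky : y ≤ 2 * k := by
    have : y < k + 1 := by rw [hk]; exact Nat.lt_floor_add_one y
    linarith
  set M : ℕ := max k (T.sup id) with hM
  have hsub : T ⊆ Ioc k M := by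
    intro n hn
    rw [mem_Ioc]
    constructor
    · by_contra hle
      push Not at hle
      have h1 : (n : ℝ) ≤ k := by exact_mod_cast hle
      have h2 : (k : ℝ) ≤ y := by rw [hk]; exact Nat.floor_le hy0
      linarith [hT n hn]
    · exact (le_sup (f := id) hn).trans (le_max_right _ _)
  calc ∑ n ∈ T, ((n : ℝ) ^ 2)⁻¹ ≤ ∑ n ∈ Ioc k M, ((n : ℝ) ^ 2)⁻¹ :=
        sum_le_sum_of_subset_of_nonneg hsub fun n _ _ => by positivity
    _ ≤ (k : ℝ)⁻¹ - (M : ℝ)⁻¹ := sum_Ioc_inv_sq_le_sub hk0 (le_max_left _ _)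
    _ ≤ (k : ℝ)⁻¹ := by
        have : (0 : ℝ) ≤ (M : ℝ)⁻¹ := by positivity
        linarith
    _ ≤ 2 / y := by
        rw [inv_eq_one_div, div_le_div_iff₀ hkpos (by linarith)]
        linarith


/-! ### Dyadic decomposition: Lemma 7.1 summed over a range `[a, b)` of norms -/

/-- The dyadic index of an integer `q ≥ 2`: the `j` with `2^j < q ≤ 2^{j+1}`. [folklore] -/
def dyadIdx (q : ℕ) : ℕ := Nat.log 2 (q - 1)

/-- `2^j < q` for `j` the dyadic index of `q ≥ 2`. [folklore] -/
theorem pow_dyadIdx_lt {q : ℕ} (hq : 2 ≤ q) : 2 ^ dyadIdx q < q := by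
  have h := Nat.pow_log_le_self 2 (show q - 1 ≠ 0 by omega)
  unfold dyadIdx
  omega

/-- `q ≤ 2^{j+1}` for `j` the dyadic index of `q`. [folklore] -/
theorem le_pow_dyadIdx_succ (q : ℕ) : q ≤ 2 ^ (dyadIdx q + 1) := by
  have h := Nat.lt_pow_succ_log_self (b := 2) one_lt_two (q - 1)
  unfold dyadIdx
  omega

/-- The dyadic index of `q < b` is at most `log b / log 2`. [folklore] -/
theorem dyadIdx_le_log {q : ℕ} {b : ℝ} (hq : 2 ≤ q) (hqb : (q : ℝ) < b) :
    (dyadIdx q : ℝ) ≤ Real.log b / Real.log 2 := by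
  have h1 : (2 : ℝ) ^ (dyadIdx q) < b := by
    calc (2 : ℝ) ^ dyadIdx q = ((2 ^ dyadIdx q : ℕ) : ℝ) := by push_cast; ring
      _ < q := by exact_mod_cast pow_dyadIdx_lt hq
      _ < b := hqb
  have h2 : (dyadIdx q : ℝ) * Real.log 2 < Real.log b := by
    rw [← Real.log_pow]
    exact Real.log_lt_log (by positivity) h1
  rw [le_div_iff₀ (Real.log_pos one_lt_two)]
  exact h2.le

/-- **Lemma 7.1 summed dyadically.** If a function `S` of ideals satisfies the
conclusion of Lemma 7.1 on every dyadic block `(N, 2N]`, `0 < N ≤ X^{2−2τ}` (main term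
`M/log min(z, X^{2−τ}/N)` times `∑ 1/q`, error `Err`), then over any set `𝒬` of square-free
integers in `[a, b)` with `2 ≤ a ≤ b ≤ X^{2−2τ}` and `min(z, X^{2−τ}/b) > 1`,
`∑_{N(Q) ∈ 𝒬} S(Q) ≤ C (M/log min(z, X^{2−τ}/b)) ∑_{q∈𝒬} 1/q + (log b/log 2 + 1) C·Err`
(at most `log b/log 2 + 1` blocks meet `[a, b)`). This is how Lemma 7.1 is applied on pp. 41–42.
[cite: HeathBrownActa2001, §7 pp. 41–42] -/
theorem dyadic_sum_le {X τ z C M Err a b : ℝ} {S : Ideal (𝓞 K) → ℝ}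
    (h71 : ∀ (N : ℝ) (𝒬 : Finset ℕ), 0 < N → N ≤ X ^ (2 - 2 * τ) →
        (∀ q ∈ 𝒬, Squarefree q ∧ N < q ∧ (q : ℝ) ≤ 2 * N) →
        ∑ Q ∈ normIn 𝒬, S Q ≤
          C * (M / Real.log (min z (X ^ (2 - τ) / N)) * ∑ q ∈ 𝒬, (q : ℝ)⁻¹ + Err))
    (hC : 0 ≤ C) (hM : 0 ≤ M) (hErr : 0 ≤ Err) (hX : 0 < X) (ha : 2 ≤ a) (hab : a ≤ b)
    (hb : b ≤ X ^ (2 - 2 * τ)) (hm : 1 < min z (X ^ (2 - τ) / b))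
    (𝒬 : Finset ℕ) (h𝒬 : ∀ q ∈ 𝒬, Squarefree q ∧ a ≤ (q : ℝ) ∧ (q : ℝ) < b) :
    ∑ Q ∈ normIn 𝒬, S Q ≤
      C * (M / Real.log (min z (X ^ (2 - τ) / b)) * ∑ q ∈ 𝒬, (q : ℝ)⁻¹) +
        (Real.log b / Real.log 2 + 1) * (C * Err) := by
  classical
  set ℓ : ℝ := Real.log (min z (X ^ (2 - τ) / b)) with hℓ
  have hℓ0 : 0 < ℓ := Real.log_pos hm
  have hb2 : 2 ≤ b := ha.trans hab
  have hb0 : 0 < b := by linarith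
  have hXp : 0 < X ^ (2 - τ) := Real.rpow_pos_of_pos hX _
  have hz0 : 0 < z := lt_of_lt_of_le (zero_lt_one.trans hm) (min_le_left _ _)
  have hq2 : ∀ q ∈ 𝒬, 2 ≤ q := fun q hq => by
    have h := ha.trans (h𝒬 q hq).2.1
    exact_mod_cast h
  set J : Finset ℕ := 𝒬.image dyadIdx with hJ
  set blk : ℕ → Finset ℕ := fun j => 𝒬.filter fun q => dyadIdx q = j with hblk
  -- the fibre of `normIn 𝒬` over `j` is `normIn (blk j)`
  have hfib : ∀ j, (normIn 𝒬).filter (fun Q => dyadIdx (Ideal.absNorm Q) = j) = normIn (blk j) := by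
    intro j
    ext Q
    simp only [mem_filter, mem_normIn_iff, hblk]
  -- each block estimate
  have hblock : ∀ j ∈ J, ∑ Q ∈ normIn (blk j), S Q ≤
      C * (M / ℓ * ∑ q ∈ blk j, (q : ℝ)⁻¹) + C * Err := by
    intro j hj
    obtain ⟨q₀, hq₀, hjq₀⟩ := mem_image.mp hj
    have hNpos : (0 : ℝ) < (2 : ℝ) ^ j := by positivity
    have hNb : (2 : ℝ) ^ j < b := by
      calc (2 : ℝ) ^ j = ((2 ^ dyadIdx q₀ : ℕ) : ℝ) := by rw [← hjq₀]; push_cast; ring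
        _ < q₀ := by exact_mod_cast pow_dyadIdx_lt (hq2 q₀ hq₀)
        _ < b := (h𝒬 q₀ hq₀).2.2
    have hNX : (2 : ℝ) ^ j ≤ X ^ (2 - 2 * τ) := (hNb.le.trans hb)
    have hmem : ∀ q ∈ blk j, Squarefree q ∧ (2 : ℝ) ^ j < q ∧ (q : ℝ) ≤ 2 * (2 : ℝ) ^ j := by
      intro q hq
      rw [hblk, mem_filter] at hq
      obtain ⟨hq𝒬, hqj⟩ := hq
      refine ⟨(h𝒬 q hq𝒬).1, ?_, ?_⟩
      · calc (2 : ℝ) ^ j = ((2 ^ dyadIdx q : ℕ) : ℝ) := by rw [← hqj]; push_cast; ring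
          _ < q := by exact_mod_cast pow_dyadIdx_lt (hq2 q hq𝒬)
      · calc (q : ℝ) ≤ ((2 ^ (dyadIdx q + 1) : ℕ) : ℝ) := by exact_mod_cast le_pow_dyadIdx_succ q
          _ = 2 * (2 : ℝ) ^ j := by rw [← hqj]; push_cast; ring
    have h := h71 ((2 : ℝ) ^ j) (blk j) hNpos hNX hmem
    -- compare the logarithms
    have hmin : min z (X ^ (2 - τ) / b) ≤ min z (X ^ (2 - τ) / (2 : ℝ) ^ j) :=
      min_le_min le_rfl (div_le_div_of_nonneg_left hXp.le hNpos hNb.le)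
    have hlog : ℓ ≤ Real.log (min z (X ^ (2 - τ) / (2 : ℝ) ^ j)) :=
      Real.log_le_log (zero_lt_one.trans hm) hmin
    have hsum0 : 0 ≤ ∑ q ∈ blk j, (q : ℝ)⁻¹ := sum_nonneg fun q _ => by positivity
    calc ∑ Q ∈ normIn (blk j), S Q
        ≤ C * (M / Real.log (min z (X ^ (2 - τ) / (2 : ℝ) ^ j)) * ∑ q ∈ blk j, (q : ℝ)⁻¹ + Err) := h
      _ ≤ C * (M / ℓ * ∑ q ∈ blk j, (q : ℝ)⁻¹ + Err) := by
          have : M / Real.log (min z (X ^ (2 - τ) / (2 : ℝ) ^ j)) ≤ M / ℓ :=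
            div_le_div_of_nonneg_left hM hℓ0 hlog
          gcongr
      _ = C * (M / ℓ * ∑ q ∈ blk j, (q : ℝ)⁻¹) + C * Err := by ring
  -- sum the blocks
  have hLHS : ∑ Q ∈ normIn 𝒬, S Q = ∑ j ∈ J, ∑ Q ∈ normIn (blk j), S Q := by
    rw [← sum_fiberwise_of_maps_to (s := normIn 𝒬) (t := J)
      (g := fun Q => dyadIdx (Ideal.absNorm Q))
      (fun Q hQ => mem_image_of_mem _ (mem_normIn_iff.mp hQ))]
    exact sum_congr rfl fun j _ => by rw [hfib]
  have hrecip : ∑ j ∈ J, ∑ q ∈ blk j, (q : ℝ)⁻¹ = ∑ q ∈ 𝒬, (q : ℝ)⁻¹ := by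
    rw [hblk]
    exact sum_fiberwise_of_maps_to (g := dyadIdx) (fun q hq => mem_image_of_mem _ hq) _
  have hcardJ : (#J : ℝ) ≤ Real.log b / Real.log 2 + 1 := by
    have hsub : J ⊆ range (⌊Real.log b / Real.log 2⌋₊ + 1) := by
      intro j hj
      obtain ⟨q₀, hq₀, rfl⟩ := mem_image.mp hj
      rw [mem_range, Nat.lt_add_one_iff]
      exact Nat.le_floor (dyadIdx_le_log (hq2 q₀ hq₀) (h𝒬 q₀ hq₀).2.2)
    have hlog0 : 0 ≤ Real.log b / Real.log 2 :=
      div_nonneg (Real.log_nonneg (by linarith)) (Real.log_nonneg one_le_two)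
    calc (#J : ℝ) ≤ #(range (⌊Real.log b / Real.log 2⌋₊ + 1)) := by exact_mod_cast card_le_card hsub
      _ = (⌊Real.log b / Real.log 2⌋₊ : ℝ) + 1 := by rw [card_range]; push_cast; ring
      _ ≤ Real.log b / Real.log 2 + 1 := by linarith [Nat.floor_le hlog0]
  calc ∑ Q ∈ normIn 𝒬, S Q = ∑ j ∈ J, ∑ Q ∈ normIn (blk j), S Q := hLHS
    _ ≤ ∑ j ∈ J, (C * (M / ℓ * ∑ q ∈ blk j, (q : ℝ)⁻¹) + C * Err) := sum_le_sum hblock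
    _ = C * (M / ℓ * ∑ q ∈ 𝒬, (q : ℝ)⁻¹) + #J * (C * Err) := by
        rw [sum_add_distrib, sum_const, nsmul_eq_mul, ← hrecip, mul_sum, mul_sum]
    _ ≤ C * (M / ℓ * ∑ q ∈ 𝒬, (q : ℝ)⁻¹) + (Real.log b / Real.log 2 + 1) * (C * Err) := by
        gcongr

/-! ### The parameters: `τ = (log log X)^{−ϖ}` and the absorption of polynomially small terms -/

set_option maxHeartbeats 400000 in
/-- **Eventually (in `X`)**: `X ≥ 16`, `0 < τ ≤ 1/8`, `1/log X ≤ τ`, and for given `A > 0`, `k`,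
`A X^{−τ/5} (log X)^k ≤ τ e^{−2(log X)^{1/3}}/log X`; here `τ = (log log X)^{−ϖ}` with `0 < ϖ ≤ 1`.
The last inequality absorbs every term `X^{2−τ/5}(log X)^k` (resp. `ηX^{2−τ/5}(log X)^k`) into
`τη²X²/log X` for all `η ≥ exp(−(log X)^{1/3})` ((2.1)), as on p. 41 ("by (2.1) and (2.5)").
[cite: HeathBrownActa2001, §7 p. 41] -/
theorem eventually_upperBound_params {ϖ : ℝ} (hϖ0 : 0 < ϖ) (hϖ1 : ϖ ≤ 1) {A : ℝ} (hA : 0 < A)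
    (k : ℕ) :
    ∀ᶠ X : ℝ in atTop, 16 ≤ X ∧ 0 < hbTau ϖ X ∧ hbTau ϖ X ≤ 1 / 8 ∧
      (Real.log X)⁻¹ ≤ hbTau ϖ X ∧
      A * X ^ (-hbTau ϖ X / 5) * Real.log X ^ k ≤
        hbTau ϖ X * Real.exp (-2 * Real.log X ^ (1 / 3 : ℝ)) / Real.log X := by
  -- (a) `log L ≤ L^{1/3}` for `L = log X` large
  have hlog : ∀ᶠ L : ℝ in atTop, ‖Real.log L‖ ≤ 1 * ‖L ^ (1 / 3 : ℝ)‖ :=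
    (isLittleO_log_rpow_atTop (by norm_num : (0 : ℝ) < 1 / 3)).def zero_lt_one
  -- (b) `M = log log X ≥ M₀`
  set M₀ : ℝ := max 1 ((8 : ℝ) ^ (1 / ϖ)) with hM₀
  have hM : ∀ᶠ X : ℝ in atTop, M₀ ≤ Real.log (Real.log X) :=
    (Real.tendsto_log_atTop.comp Real.tendsto_log_atTop).eventually (eventually_ge_atTop _)
  -- (c) `L^{1/3} ≥ B`
  set B : ℝ := max 20 (10 * (k + 3 + |Real.log A|)) with hB
  have hL3 : ∀ᶠ X : ℝ in atTop, B ≤ Real.log X ^ (1 / 3 : ℝ) :=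
    ((tendsto_rpow_atTop (by norm_num : (0 : ℝ) < 1 / 3)).comp Real.tendsto_log_atTop).eventually
      (eventually_ge_atTop _)
  filter_upwards [eventually_ge_atTop (16 : ℝ), Real.tendsto_log_atTop.eventually hlog, hM, hL3,
    Real.tendsto_log_atTop.eventually (eventually_ge_atTop (3 : ℝ))] with X hX16 hlogX hMX hL3X hL3'
  set L := Real.log X with hL
  set M := Real.log L with hMdef
  have hX0 : 0 < X := by linarith
  have hL0 : 0 < L := by linarith
  have hM1 : 1 ≤ M := le_trans (le_max_left _ _) hMX
  have hM0 : 0 < M := by linarith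
  -- τ = (M^ϖ)⁻¹
  have hτ : hbTau ϖ X = (M ^ ϖ)⁻¹ := by
    rw [hbTau, ← hL, ← hMdef, Real.rpow_neg hM0.le]
  have hMϖ0 : 0 < M ^ ϖ := Real.rpow_pos_of_pos hM0 _
  have hτ0 : 0 < hbTau ϖ X := by rw [hτ]; positivity
  -- `M^ϖ ≥ 8`
  have hM8 : (8 : ℝ) ≤ M ^ ϖ := by
    have h8 : (8 : ℝ) ^ (1 / ϖ) ≤ M := le_trans (le_max_right _ _) hMX
    calc (8 : ℝ) = ((8 : ℝ) ^ (1 / ϖ)) ^ ϖ := by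
          rw [← Real.rpow_mul (by norm_num), one_div, inv_mul_cancel₀ hϖ0.ne', Real.rpow_one]
      _ ≤ M ^ ϖ := Real.rpow_le_rpow (by positivity) h8 hϖ0.le
  have hτ8 : hbTau ϖ X ≤ 1 / 8 := by
    rw [hτ, inv_eq_one_div]
    exact div_le_div_of_nonneg_left zero_le_one (by norm_num) hM8
  -- `M^ϖ ≤ M ≤ L^{1/3} ≤ L`
  have hMϖM : M ^ ϖ ≤ M := by
    calc M ^ ϖ ≤ M ^ (1 : ℝ) := Real.rpow_le_rpow_of_exponent_le hM1 hϖ1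
      _ = M := Real.rpow_one M
  have hL13 : 0 < L ^ (1 / 3 : ℝ) := Real.rpow_pos_of_pos hL0 _
  have hML3 : M ≤ L ^ (1 / 3 : ℝ) := by
    have h := hlogX
    rw [Real.norm_eq_abs, Real.norm_eq_abs, one_mul, abs_of_pos hL13] at h
    exact le_trans (le_abs_self M) h
  have hL3L : L ^ (1 / 3 : ℝ) ≤ L := by
    have hL1 : 1 ≤ L := by linarith
    calc L ^ (1 / 3 : ℝ) ≤ L ^ (1 : ℝ) := Real.rpow_le_rpow_of_exponent_le hL1 (by norm_num)
      _ = L := Real.rpow_one L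
  have hτL : L⁻¹ ≤ hbTau ϖ X := by
    rw [hτ]
    exact inv_anti₀ hMϖ0 (hMϖM.trans (hML3.trans hL3L))
  -- the main inequality
  have hmain : A * X ^ (-hbTau ϖ X / 5) * L ^ k ≤
      hbTau ϖ X * Real.exp (-2 * L ^ (1 / 3 : ℝ)) / L := by
    -- rewrite `X^{-τ/5} = exp(-τ L / 5)` and use `τ ≥ 1/M`, `M ≤ L^{1/3}`
    have hXpow : X ^ (-hbTau ϖ X / 5) = Real.exp (-(hbTau ϖ X * L / 5)) := by
      rw [Real.rpow_def_of_pos hX0, ← hL]; ring_nf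
    have hB20 : (20 : ℝ) ≤ L ^ (1 / 3 : ℝ) := le_trans (le_max_left _ _) hL3X
    have hBk : 10 * (k + 3 + |Real.log A|) ≤ L ^ (1 / 3 : ℝ) := le_trans (le_max_right _ _) hL3X
    set T := L ^ (1 / 3 : ℝ) with hT
    have hT3 : T ^ 3 = L := by
      rw [hT, ← Real.rpow_natCast, ← Real.rpow_mul hL0.le]; norm_num
    -- (1) `τ L / 5 ≥ T²/5`: since `τ ≥ 1/M ≥ 1/T` and `L = T³`
    have hτT : T ^ 2 / 5 ≤ hbTau ϖ X * L / 5 := by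
      have h1 : T⁻¹ ≤ hbTau ϖ X := by
        rw [hτ]; exact inv_anti₀ hMϖ0 (hMϖM.trans hML3)
      have : T ^ 2 = T⁻¹ * L := by
        rw [← hT3]; field_simp
      rw [this]
      gcongr
    -- (2) `log A + (k+1) log L + log(M^ϖ) ≤ T²/5 − 2T`, using `log L ≤ T`, `M^ϖ ≤ T`, `T ≥ 20`,
    --     `T ≥ 10(k+3+|log A|)`
    have hlogL : Real.log L ≤ T := hML3
    have hlogMϖ : Real.log (M ^ ϖ) ≤ T := by
      have h1 : Real.log (M ^ ϖ) ≤ M ^ ϖ - 1 := Real.log_le_sub_one_of_pos hMϖ0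
      linarith [hMϖM.trans hML3]
    have hT1 : 1 ≤ T := by linarith
    have hkey : Real.log A + (k + 1) * Real.log L + Real.log (M ^ ϖ) ≤ T ^ 2 / 5 - 2 * T := by
      have hA' : Real.log A ≤ |Real.log A| := le_abs_self _
      have hk0 : (0 : ℝ) ≤ k := Nat.cast_nonneg k
      have hlogL0 : 0 ≤ Real.log L := Real.log_nonneg (by linarith)
      -- LHS ≤ |log A| + (k+1) T + T ≤ (k + 3 + |log A|) T  (as T ≥ 1)
      have h1 : Real.log A + (k + 1) * Real.log L + Real.log (M ^ ϖ) ≤ (k + 3 + |Real.log A|) * T := by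
        nlinarith [abs_nonneg (Real.log A)]
      -- (k+3+|log A|) T ≤ T²/10 and T²/10 ≤ T²/5 − 2T
      have h2 : (k + 3 + |Real.log A|) * T ≤ T ^ 2 / 10 := by nlinarith [abs_nonneg (Real.log A)]
      have h3 : T ^ 2 / 10 ≤ T ^ 2 / 5 - 2 * T := by nlinarith
      linarith
    -- (3) exponentiate
    have hexp : A * L ^ k * (M ^ ϖ) * L ≤ Real.exp (hbTau ϖ X * L / 5 - 2 * T) := by
      have hpos : 0 < A * L ^ k * (M ^ ϖ) * L := by positivity
      rw [← Real.log_le_iff_le_exp hpos]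
      have : Real.log (A * L ^ k * M ^ ϖ * L) =
          Real.log A + (k + 1) * Real.log L + Real.log (M ^ ϖ) := by
        rw [Real.log_mul (by positivity) hL0.ne', Real.log_mul (by positivity) hMϖ0.ne',
          Real.log_mul hA.ne' (by positivity), Real.log_pow]
        ring
      rw [this]
      linarith [hkey, hτT]
    -- conclude
    rw [hXpow, Real.exp_neg]
    rw [show Real.exp (hbTau ϖ X * L / 5 - 2 * T) =
        Real.exp (hbTau ϖ X * L / 5) * Real.exp (-2 * T) by rw [← Real.exp_add]; ring_nf] at hexp
    set E := Real.exp (hbTau ϖ X * L / 5) with hEdef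
    have hE : 0 < E := Real.exp_pos _
    have hτ' : hbTau ϖ X = (M ^ ϖ)⁻¹ := hτ
    rw [hτ']
    rw [show A * E⁻¹ * L ^ k = (A * L ^ k * M ^ ϖ * L) * (E⁻¹ * (M ^ ϖ)⁻¹ * L⁻¹) by
      field_simp]
    calc A * L ^ k * M ^ ϖ * L * (E⁻¹ * (M ^ ϖ)⁻¹ * L⁻¹)
        ≤ E * Real.exp (-2 * T) * (E⁻¹ * (M ^ ϖ)⁻¹ * L⁻¹) :=
          mul_le_mul_of_nonneg_right hexp (by positivity)
      _ = (M ^ ϖ)⁻¹ * Real.exp (-2 * T) / L := by field_simp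
  exact ⟨hX16, hτ0, hτ8, hτL, hmain⟩



/-! ### Rational primes in a range -/

/-- The rational primes `p` with `a ≤ p < b`. [folklore] -/
def primesIco (a b : ℝ) : Finset ℕ :=
  (range (⌊b⌋₊ + 1)).filter fun p => p.Prime ∧ a ≤ (p : ℝ) ∧ (p : ℝ) < b

/-- Membership in `primesIco`: the bounding range is redundant. [folklore] -/
theorem mem_primesIco_iff {a b : ℝ} {p : ℕ} :
    p ∈ primesIco a b ↔ p.Prime ∧ a ≤ (p : ℝ) ∧ (p : ℝ) < b := by
  simp only [primesIco, mem_filter, mem_range, and_iff_right_iff_imp]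
  rintro ⟨hp, -, hb⟩
  have hb0 : 0 ≤ b := le_trans (Nat.cast_nonneg p) hb.le
  exact Nat.lt_add_one_iff.mpr (Nat.le_floor hb.le)

/-- **`∑_{a ≤ p < b} 1/p ≤ (log(2b/a) + K₁)/log(a/2)`** for `4 ≤ a ≤ b` (the window bound with
`lo = a/2`, `hi = b`). [folklore] -/
theorem sum_primesIco_inv_le {K₁ : ℝ}
    (hK : ∀ (lo hi : ℝ) (T : Finset ℕ), 2 ≤ lo → lo ≤ hi →
      (∀ p ∈ T, p.Prime ∧ lo < (p : ℝ) ∧ (p : ℝ) ≤ hi) →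
      ∑ p ∈ T, (p : ℝ)⁻¹ ≤ (Real.log (hi / lo) + K₁) / Real.log lo)
    {a b : ℝ} (ha : 4 ≤ a) (hab : a ≤ b) :
    ∑ p ∈ primesIco a b, (p : ℝ)⁻¹ ≤ (Real.log (2 * b / a) + K₁) / Real.log (a / 2) := by
  have h := hK (a / 2) b (primesIco a b) (by linarith) (by linarith) fun p hp => by
    rw [mem_primesIco_iff] at hp
    exact ⟨hp.1, by linarith [hp.2.1], hp.2.2.le⟩
  rwa [show b / (a / 2) = 2 * b / a by field_simp] at h

/-! ### The single-prime pieces `S₃`, `S₅`: `∑_{a ≤ N(P) < b} S_K(𝒵_P, N(P))` (p. 41) -/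

/-- **The pieces `S₃(𝒜)`, `S₅(𝒜)` via Lemma 7.1** (p. 41: "By Lemma 3.1, we may assume that `N(P)` is
prime. Thus Lemma 7.1 yields `S₃(𝒜) ≪ ∑_{X^{1−τ} ≤ p < X^{1+τ}} η²X²/(p log X) + X^{2−τ/5} …`"): for a
range `X^{1/2} ≤ a ≤ b ≤ X^{2−2τ}` with `min(X^{1/2}, X^{2−τ}/b) ≥ X^{1/4}`, lowering the sifting
level to `z = X^{1/2}` and summing Lemma 7.1 (in the form `h71A`, at level `z`) over dyadic blocks,
`∑_{a ≤ N(P) < b} S_K^≺(𝒜^(K)_P, P) ≤ C (η²X²/log X^{1/4}) ∑_{a ≤ p < b} 1/p + (log b/log 2 + 1) C X^{2−τ/5}`.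
[cite: HeathBrownActa2001, §7 p. 41] -/
theorem primeRangeSum_boxPairs_le {X η τ C a b : ℝ} (hX : 16 ≤ X) (hC : 0 ≤ C)
    (ha : X ^ (1 / 2 : ℝ) ≤ a) (hab : a ≤ b) (hb : b ≤ X ^ (2 - 2 * τ))
    (hm : X ^ (1 / 4 : ℝ) ≤ min (X ^ (1 / 2 : ℝ)) (X ^ (2 - τ) / b))
    (h71A : ∀ (N : ℝ) (𝒬 : Finset ℕ), 0 < N → N ≤ X ^ (2 - 2 * τ) →
        (∀ q ∈ 𝒬, Squarefree q ∧ N < q ∧ (q : ℝ) ≤ 2 * N) →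
        ∑ Q ∈ normIn 𝒬, (siftedA X η Q (X ^ (1 / 2 : ℝ)) : ℝ) ≤
          C * (η ^ 2 * X ^ 2 / Real.log (min (X ^ (1 / 2 : ℝ)) (X ^ (2 - τ) / N)) *
            ∑ q ∈ 𝒬, (q : ℝ)⁻¹ + X ^ (2 - τ / 5))) :
    (primeRangeSum (boxPairs X η) pairIdeal a b : ℝ) ≤
      C * (η ^ 2 * X ^ 2 / Real.log (X ^ (1 / 4 : ℝ))) * ∑ p ∈ primesIco a b, (p : ℝ)⁻¹ +
        (Real.log b / Real.log 2 + 1) * (C * X ^ (2 - τ / 5)) := by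
  classical
  have hX0 : 0 < X := by linarith
  have hX1 : 1 < X := by linarith
  set z : ℝ := X ^ (1 / 2 : ℝ) with hz
  have hz4 : 4 ≤ z := by
    calc (4 : ℝ) = (16 : ℝ) ^ (1 / 2 : ℝ) := by
          rw [show (16 : ℝ) = 4 ^ (2 : ℝ) by norm_num, ← Real.rpow_mul (by norm_num)]; norm_num
      _ ≤ X ^ (1 / 2 : ℝ) := Real.rpow_le_rpow (by norm_num) hX (by norm_num)
  have ha2 : 2 ≤ a := by linarith
  have hX14 : 1 < X ^ (1 / 4 : ℝ) := Real.one_lt_rpow hX1 (by norm_num)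
  have hm1 : 1 < min (X ^ (1 / 2 : ℝ)) (X ^ (2 - τ) / b) := lt_of_lt_of_le hX14 hm
  set Pset := primesNormIco a b with hPset
  -- Step 1: lower the sifting level to `z ≤ a ≤ N(P)`
  have step1 : (primeRangeSum (boxPairs X η) pairIdeal a b : ℝ) ≤
      ∑ P ∈ Pset, (famSifted (boxPairs X η) pairIdeal P z : ℝ) := by
    rw [primeRangeSum, Nat.cast_sum]
    refine sum_le_sum fun P hP => ?_
    have hNP : z ≤ Ideal.absNorm P := ha.trans ((mem_primesNormIco_iff.mp hP).2.2.1)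
    exact_mod_cast famSiftedAbove_le_famSifted _ _ P P hNP
  -- Step 2: only `P` of prime norm contribute (Lemma 3.1)
  set good := Pset.filter fun P => (Ideal.absNorm P).Prime with hgood
  have step2 : ∑ P ∈ Pset, (famSifted (boxPairs X η) pairIdeal P z : ℝ) =
      ∑ P ∈ good, (famSifted (boxPairs X η) pairIdeal P z : ℝ) := by
    rw [hgood, sum_filter_of_ne]
    intro P hP hne
    by_contra hnp
    obtain ⟨hPp, hP0, -, -⟩ := mem_primesNormIco_iff.mp hP
    have h0 : famSifted (boxPairs X η) pairIdeal P z = 0 := by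
      have h := famSifted_le_famCount (boxPairs X η) pairIdeal P z
      rw [famCount_boxPairs, countA_eq_zero_of_not_prime hPp hP0 dvd_rfl hnp] at h
      exact Nat.le_zero.mp h
    exact hne (by rw [h0, Nat.cast_zero])
  -- Step 3: embed into `normIn 𝒬`, `𝒬` the (prime) norms of the good `P`
  set 𝒬 := good.image Ideal.absNorm with h𝒬def
  have hsub : good ⊆ normIn 𝒬 := fun P hP => mem_normIn_iff.mpr (mem_image_of_mem _ hP)
  have step3 : ∑ P ∈ good, (famSifted (boxPairs X η) pairIdeal P z : ℝ) ≤
      ∑ Q ∈ normIn 𝒬, (siftedA X η Q z : ℝ) := by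
    calc ∑ P ∈ good, (famSifted (boxPairs X η) pairIdeal P z : ℝ)
        = ∑ P ∈ good, (siftedA X η P z : ℝ) :=
          sum_congr rfl fun P _ => by rw [siftedA_eq_famSifted]
      _ ≤ ∑ Q ∈ normIn 𝒬, (siftedA X η Q z : ℝ) :=
          sum_le_sum_of_subset_of_nonneg hsub fun Q _ _ => Nat.cast_nonneg _
  have h𝒬 : ∀ q ∈ 𝒬, Squarefree q ∧ a ≤ (q : ℝ) ∧ (q : ℝ) < b := by
    intro q hq
    obtain ⟨P, hP, rfl⟩ := mem_image.mp hq
    rw [hgood, mem_filter, mem_primesNormIco_iff] at hP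
    obtain ⟨⟨-, -, haP, hPb⟩, hprime⟩ := hP
    exact ⟨(Nat.prime_iff.mp hprime).squarefree, haP, hPb⟩
  have h𝒬sub : 𝒬 ⊆ primesIco a b := by
    intro q hq
    obtain ⟨P, hP, rfl⟩ := mem_image.mp hq
    rw [hgood, mem_filter, mem_primesNormIco_iff] at hP
    obtain ⟨⟨-, -, haP, hPb⟩, hprime⟩ := hP
    exact mem_primesIco_iff.mpr ⟨hprime, haP, hPb⟩
  -- Step 4: Lemma 7.1 over dyadic blocks
  have hM0 : 0 ≤ η ^ 2 * X ^ 2 := by positivity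
  have hErr0 : 0 ≤ X ^ (2 - τ / 5) := (Real.rpow_pos_of_pos hX0 _).le
  have step4 := dyadic_sum_le (S := fun Q => (siftedA X η Q z : ℝ)) h71A hC hM0 hErr0 hX0 ha2 hab hb
    hm1 𝒬 h𝒬
  -- Step 5: simplify the main term
  have hlog4 : 0 < Real.log (X ^ (1 / 4 : ℝ)) := Real.log_pos hX14
  have hlogm : Real.log (X ^ (1 / 4 : ℝ)) ≤ Real.log (min (X ^ (1 / 2 : ℝ)) (X ^ (2 - τ) / b)) :=
    Real.log_le_log (by linarith) hm
  have hsum𝒬 : ∑ q ∈ 𝒬, (q : ℝ)⁻¹ ≤ ∑ p ∈ primesIco a b, (p : ℝ)⁻¹ :=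
    sum_le_sum_of_subset_of_nonneg h𝒬sub fun p _ _ => by positivity
  have hsum0 : 0 ≤ ∑ q ∈ 𝒬, (q : ℝ)⁻¹ := sum_nonneg fun q _ => by positivity
  calc (primeRangeSum (boxPairs X η) pairIdeal a b : ℝ)
      ≤ ∑ Q ∈ normIn 𝒬, (siftedA X η Q z : ℝ) := step1.trans (step2 ▸ step3)
    _ ≤ C * (η ^ 2 * X ^ 2 / Real.log (min (X ^ (1 / 2 : ℝ)) (X ^ (2 - τ) / b)) *
            ∑ q ∈ 𝒬, (q : ℝ)⁻¹) + (Real.log b / Real.log 2 + 1) * (C * X ^ (2 - τ / 5)) := step4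
    _ ≤ C * (η ^ 2 * X ^ 2 / Real.log (X ^ (1 / 4 : ℝ)) * ∑ p ∈ primesIco a b, (p : ℝ)⁻¹) +
          (Real.log b / Real.log 2 + 1) * (C * X ^ (2 - τ / 5)) := by
        have h1 : η ^ 2 * X ^ 2 / Real.log (min (X ^ (1 / 2 : ℝ)) (X ^ (2 - τ) / b)) ≤
            η ^ 2 * X ^ 2 / Real.log (X ^ (1 / 4 : ℝ)) :=
          div_le_div_of_nonneg_left hM0 hlog4 hlogm
        have h2 : 0 ≤ η ^ 2 * X ^ 2 / Real.log (X ^ (1 / 4 : ℝ)) := div_nonneg hM0 hlog4.le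
        gcongr
    _ = _ := by ring

/-- **The pieces `S₃(ℬ)`, `S₅(ℬ)` via Lemma 7.1** (p. 41: "One may handle `S₃(ℬ)` in much the same way.
We no longer know that `N(P)` is prime. The contribution from prime ideals `P` of degree `2`,
however, is `≪ ∑ #ℬ^(K)_P ≪ ∑_{N(P) ≥ X^{1/2}} X³/N(P) ≪ X^{11/4}` … Inert primes may be handled
similarly"): as for `𝒜^(K)`, plus the prime ideals of non-prime norm in the range, at most
`3(√b + 1)` of them, each with `#ℬ^(K)_P ≤ C_ℬ X³/a`.
[cite: HeathBrownActa2001, §7 p. 41] -/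
theorem primeRangeSum_normWindow_le {X η τ C C_B a b : ℝ} (hX : 16 ≤ X) (hC : 0 ≤ C) (hCB : 0 ≤ C_B)
    (hη0 : 0 ≤ η)
    (ha : X ^ (1 / 2 : ℝ) ≤ a) (hab : a ≤ b) (hb : b ≤ X ^ (2 - 2 * τ))
    (hm : X ^ (1 / 4 : ℝ) ≤ min (X ^ (1 / 2 : ℝ)) (X ^ (2 - τ) / b))
    (h71B : ∀ (N : ℝ) (𝒬 : Finset ℕ), 0 < N → N ≤ X ^ (2 - 2 * τ) →
        (∀ q ∈ 𝒬, Squarefree q ∧ N < q ∧ (q : ℝ) ≤ 2 * N) →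
        ∑ Q ∈ normIn 𝒬, (siftedB X η Q (X ^ (1 / 2 : ℝ)) : ℝ) ≤
          C * (η * X ^ 3 / Real.log (min (X ^ (1 / 2 : ℝ)) (X ^ (2 - τ) / N)) *
            ∑ q ∈ 𝒬, (q : ℝ)⁻¹ + X ^ (3 - τ / 5)))
    (hcountB : ∀ R : Ideal (𝓞 K), R ≠ ⊥ → (countB X η R : ℝ) ≤ C_B * X ^ 3 / Ideal.absNorm R) :
    (primeRangeSum (normWindow X η) (fun J => J) a b : ℝ) ≤
      C * (η * X ^ 3 / Real.log (X ^ (1 / 4 : ℝ))) * ∑ p ∈ primesIco a b, (p : ℝ)⁻¹ +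
        (Real.log b / Real.log 2 + 1) * (C * X ^ (3 - τ / 5)) +
        3 * (Real.sqrt b + 1) * (C_B * X ^ 3 / a) := by
  classical
  have hX0 : 0 < X := by linarith
  have hX1 : 1 < X := by linarith
  set z : ℝ := X ^ (1 / 2 : ℝ) with hz
  have hz4 : 4 ≤ z := by
    calc (4 : ℝ) = (16 : ℝ) ^ (1 / 2 : ℝ) := by
          rw [show (16 : ℝ) = 4 ^ (2 : ℝ) by norm_num, ← Real.rpow_mul (by norm_num)]; norm_num
      _ ≤ X ^ (1 / 2 : ℝ) := Real.rpow_le_rpow (by norm_num) hX (by norm_num)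
  have ha2 : 2 ≤ a := by linarith
  have ha0 : 0 < a := by linarith
  have hX14 : 1 < X ^ (1 / 4 : ℝ) := Real.one_lt_rpow hX1 (by norm_num)
  have hm1 : 1 < min (X ^ (1 / 2 : ℝ)) (X ^ (2 - τ) / b) := lt_of_lt_of_le hX14 hm
  set Pset := primesNormIco a b with hPset
  set E := normWindow X η with hE
  -- Step 1: lower the sifting level to `z ≤ a ≤ N(P)`
  have step1 : (primeRangeSum E (fun J => J) a b : ℝ) ≤
      ∑ P ∈ Pset, (famSifted E (fun J => J) P z : ℝ) := by
    rw [primeRangeSum, Nat.cast_sum]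
    refine sum_le_sum fun P hP => ?_
    have hNP : z ≤ Ideal.absNorm P := ha.trans ((mem_primesNormIco_iff.mp hP).2.2.1)
    exact_mod_cast famSiftedAbove_le_famSifted _ _ P P hNP
  -- Step 2: split into prime norm (good) and the rest (bad)
  set good := Pset.filter fun P => (Ideal.absNorm P).Prime with hgood
  set bad := Pset.filter fun P => ¬ (Ideal.absNorm P).Prime with hbad
  have step2 : ∑ P ∈ Pset, (famSifted E (fun J => J) P z : ℝ) =
      ∑ P ∈ good, (famSifted E (fun J => J) P z : ℝ) +
        ∑ P ∈ bad, (famSifted E (fun J => J) P z : ℝ) := by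
    rw [hgood, hbad, sum_filter_add_sum_filter_not]
  -- Step 3 (bad): at most `3(√b+1)` primes of non-prime norm below `b`, each with `#ℬ_P ≤ C_B X³/a`
  have hbad_card : (#bad : ℝ) ≤ 3 * (Real.sqrt b + 1) := by
    have hsub : bad ⊆ (Literature.NumberTheory.LFunctions.NumberField.finite_primeIdealsLE K b).toFinset.filter
        fun P => ¬ (Ideal.absNorm P).Prime := by
      intro P hP
      rw [hbad, mem_filter, mem_primesNormIco_iff] at hP
      obtain ⟨⟨hPp, hP0, -, hPb⟩, hnp⟩ := hP
      simp only [mem_filter, Set.Finite.mem_toFinset, Literature.NumberTheory.LFunctions.NumberField.primeIdealsLE, Set.mem_setOf_eq]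
      exact ⟨⟨hPp, hP0, hPb.le⟩, hnp⟩
    calc (#bad : ℝ) ≤ #((Literature.NumberTheory.LFunctions.NumberField.finite_primeIdealsLE K b).toFinset.filter
          fun P => ¬ (Ideal.absNorm P).Prime) := by exact_mod_cast card_le_card hsub
      _ ≤ Module.finrank ℚ K * (Real.sqrt b + 1) := card_filter_not_prime_absNorm_le _
      _ = 3 * (Real.sqrt b + 1) := by rw [finrank_K]; norm_num
  have step3bad : ∑ P ∈ bad, (famSifted E (fun J => J) P z : ℝ) ≤
      3 * (Real.sqrt b + 1) * (C_B * X ^ 3 / a) := by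
    have hterm : ∀ P ∈ bad, (famSifted E (fun J => J) P z : ℝ) ≤ C_B * X ^ 3 / a := by
      intro P hP
      rw [hbad, mem_filter, mem_primesNormIco_iff] at hP
      obtain ⟨⟨hPp, hP0, haP, -⟩, -⟩ := hP
      have hNP : 0 < (Ideal.absNorm P : ℝ) := lt_of_lt_of_le ha0 haP
      calc (famSifted E (fun J => J) P z : ℝ) ≤ famCount E (fun J => J) P := by
            exact_mod_cast famSifted_le_famCount E _ P z
        _ = countB X η P := by rw [hE, famCount_normWindow]
        _ ≤ C_B * X ^ 3 / Ideal.absNorm P := hcountB P hP0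
        _ ≤ C_B * X ^ 3 / a := div_le_div_of_nonneg_left (by positivity) ha0 haP
    calc ∑ P ∈ bad, (famSifted E (fun J => J) P z : ℝ) ≤ ∑ P ∈ bad, C_B * X ^ 3 / a :=
          sum_le_sum hterm
      _ = #bad * (C_B * X ^ 3 / a) := by rw [sum_const, nsmul_eq_mul]
      _ ≤ 3 * (Real.sqrt b + 1) * (C_B * X ^ 3 / a) :=
          mul_le_mul_of_nonneg_right hbad_card (by positivity)
  -- Step 3 (good): embed into `normIn 𝒬`
  set 𝒬 := good.image Ideal.absNorm with h𝒬def
  have hsub : good ⊆ normIn 𝒬 := fun P hP => mem_normIn_iff.mpr (mem_image_of_mem _ hP)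
  have step3 : ∑ P ∈ good, (famSifted E (fun J => J) P z : ℝ) ≤
      ∑ Q ∈ normIn 𝒬, (siftedB X η Q z : ℝ) := by
    calc ∑ P ∈ good, (famSifted E (fun J => J) P z : ℝ)
        = ∑ P ∈ good, (siftedB X η P z : ℝ) :=
          sum_congr rfl fun P _ => by rw [hE, siftedB_eq_famSifted]
      _ ≤ ∑ Q ∈ normIn 𝒬, (siftedB X η Q z : ℝ) :=
          sum_le_sum_of_subset_of_nonneg hsub fun Q _ _ => Nat.cast_nonneg _
  have h𝒬 : ∀ q ∈ 𝒬, Squarefree q ∧ a ≤ (q : ℝ) ∧ (q : ℝ) < b := by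
    intro q hq
    obtain ⟨P, hP, rfl⟩ := mem_image.mp hq
    rw [hgood, mem_filter, mem_primesNormIco_iff] at hP
    obtain ⟨⟨-, -, haP, hPb⟩, hprime⟩ := hP
    exact ⟨(Nat.prime_iff.mp hprime).squarefree, haP, hPb⟩
  have h𝒬sub : 𝒬 ⊆ primesIco a b := by
    intro q hq
    obtain ⟨P, hP, rfl⟩ := mem_image.mp hq
    rw [hgood, mem_filter, mem_primesNormIco_iff] at hP
    obtain ⟨⟨-, -, haP, hPb⟩, hprime⟩ := hP
    exact mem_primesIco_iff.mpr ⟨hprime, haP, hPb⟩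
  -- Step 4: Lemma 7.1 over dyadic blocks
  have hM0 : 0 ≤ η * X ^ 3 := by positivity
  have hErr0 : 0 ≤ X ^ (3 - τ / 5) := (Real.rpow_pos_of_pos hX0 _).le
  have step4 := dyadic_sum_le (S := fun Q => (siftedB X η Q z : ℝ)) h71B hC hM0 hErr0 hX0 ha2 hab hb
    hm1 𝒬 h𝒬
  -- Step 5: simplify the main term
  have hlog4 : 0 < Real.log (X ^ (1 / 4 : ℝ)) := Real.log_pos hX14
  have hlogm : Real.log (X ^ (1 / 4 : ℝ)) ≤ Real.log (min (X ^ (1 / 2 : ℝ)) (X ^ (2 - τ) / b)) :=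
    Real.log_le_log (by linarith) hm
  have hsum𝒬 : ∑ q ∈ 𝒬, (q : ℝ)⁻¹ ≤ ∑ p ∈ primesIco a b, (p : ℝ)⁻¹ :=
    sum_le_sum_of_subset_of_nonneg h𝒬sub fun p _ _ => by positivity
  have hsum0 : 0 ≤ ∑ q ∈ 𝒬, (q : ℝ)⁻¹ := sum_nonneg fun q _ => by positivity
  have hmain : ∑ Q ∈ normIn 𝒬, (siftedB X η Q z : ℝ) ≤
      C * (η * X ^ 3 / Real.log (X ^ (1 / 4 : ℝ))) * ∑ p ∈ primesIco a b, (p : ℝ)⁻¹ +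
        (Real.log b / Real.log 2 + 1) * (C * X ^ (3 - τ / 5)) := by
    calc ∑ Q ∈ normIn 𝒬, (siftedB X η Q z : ℝ)
        ≤ C * (η * X ^ 3 / Real.log (min (X ^ (1 / 2 : ℝ)) (X ^ (2 - τ) / b)) *
            ∑ q ∈ 𝒬, (q : ℝ)⁻¹) + (Real.log b / Real.log 2 + 1) * (C * X ^ (3 - τ / 5)) := step4
      _ ≤ C * (η * X ^ 3 / Real.log (X ^ (1 / 4 : ℝ)) * ∑ p ∈ primesIco a b, (p : ℝ)⁻¹) +
            (Real.log b / Real.log 2 + 1) * (C * X ^ (3 - τ / 5)) := by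
          have h1 : η * X ^ 3 / Real.log (min (X ^ (1 / 2 : ℝ)) (X ^ (2 - τ) / b)) ≤
              η * X ^ 3 / Real.log (X ^ (1 / 4 : ℝ)) :=
            div_le_div_of_nonneg_left hM0 hlog4 hlogm
          have h2 : 0 ≤ η * X ^ 3 / Real.log (X ^ (1 / 4 : ℝ)) := div_nonneg hM0 hlog4.le
          gcongr
      _ = _ := by ring
  calc (primeRangeSum E (fun J => J) a b : ℝ)
      ≤ ∑ P ∈ good, (famSifted E (fun J => J) P z : ℝ) +
          ∑ P ∈ bad, (famSifted E (fun J => J) P z : ℝ) := step1.trans step2.le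
    _ ≤ (C * (η * X ^ 3 / Real.log (X ^ (1 / 4 : ℝ))) * ∑ p ∈ primesIco a b, (p : ℝ)⁻¹ +
          (Real.log b / Real.log 2 + 1) * (C * X ^ (3 - τ / 5))) +
          3 * (Real.sqrt b + 1) * (C_B * X ^ 3 / a) := add_le_add (step3.trans hmain) step3bad
    _ = _ := by ring



/-! ### The `U`-pieces: indices `(s, P_{n+1})`, the ideal `P_1⋯P_nP_{n+1}` and its norm -/

section UIndex

variable {X τ : ℝ}

/-- Membership in `𝒫₀ = smallPrimes`. [cite: HeathBrownActa2001, §3 (3.1)] -/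
theorem mem_smallPrimes_iff {P : Ideal (𝓞 K)} :
    P ∈ smallPrimes X τ ↔ P.IsPrime ∧ P ≠ ⊥ ∧ X ^ τ ≤ (Ideal.absNorm P : ℝ) ∧
      (Ideal.absNorm P : ℝ) < X ^ (1 - τ) := by
  rw [smallPrimes, mem_primesNormIco_iff]

/-- Membership in `chains`. [cite: HeathBrownActa2001, §3 (3.1)] -/
theorem mem_chains_iff {n : ℕ} {s : Finset (Ideal (𝓞 K))} :
    s ∈ chains X τ n ↔ s ⊆ smallPrimes X τ ∧ #s = n ∧
      ((Ideal.absNorm (∏ P ∈ s, P) : ℕ) : ℝ) < X ^ (1 + τ) := by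
  classical
  rw [chains, mem_filter, mem_powersetCard, and_assoc]

/-- Membership in `Upairs`. [cite: HeathBrownActa2001, §3 (3.1)] -/
theorem mem_Upairs_iff {n : ℕ} {t : Finset (Ideal (𝓞 K)) × Ideal (𝓞 K)} :
    t ∈ Upairs X τ n ↔ t.1 ∈ chains X τ n ∧ t.2 ∈ smallPrimes X τ ∧ (∀ P ∈ t.1, PrimeLT t.2 P) ∧
      X ^ (1 + τ) ≤ ((Ideal.absNorm (∏ P ∈ t.1, P) * Ideal.absNorm t.2 : ℕ) : ℝ) := by
  classical
  rw [Upairs, mem_filter, mem_product, and_assoc]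

end UIndex

/-- The ideal `P_1⋯P_n · P_{n+1}` attached to an index `(s, P_{n+1})`, `s = {P_1, …, P_n}`, of `U^(n)`.
[cite: HeathBrownActa2001, §3 (3.1)] -/
def uIdeal (t : Finset (Ideal (𝓞 K)) × Ideal (𝓞 K)) : Ideal (𝓞 K) := (∏ P ∈ t.1, P) * t.2

open scoped Classical in
/-- `U^(n)` restricted by a condition on `N(P_1⋯P_{n+1})`, as a sum over the filtered index set of
`famSiftedAbove` at `uIdeal`. [cite: HeathBrownActa2001, §3 p. 13] -/
theorem UpieceWhere_eq {ι : Type*} (E : Finset ι) (I : ι → Ideal (𝓞 K)) (X τ : ℝ) (n : ℕ)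
    (c : ℝ → Prop) :
    UpieceWhere E I X τ n c =
      ∑ t ∈ (Upairs X τ n).filter
          (fun t => c ((Ideal.absNorm (∏ P ∈ t.1, P) * Ideal.absNorm t.2 : ℕ) : ℝ)),
        famSiftedAbove E I (uIdeal t) t.2 := by
  rw [UpieceWhere]
  rfl

/-- The new prime `P_{n+1}` is not among `P_1, …, P_n` (it precedes them). [folklore] -/
theorem snd_notMem_fst {X τ : ℝ} {n : ℕ} {t : Finset (Ideal (𝓞 K)) × Ideal (𝓞 K)}
    (ht : t ∈ Upairs X τ n) : t.2 ∉ t.1 := fun h =>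
  primeLT_irrefl _ ((mem_Upairs_iff.mp ht).2.2.1 t.2 h)

/-- `uIdeal t` is the product over the set `{P_1, …, P_{n+1}}`. [folklore] -/
theorem uIdeal_eq_prod_insert {t : Finset (Ideal (𝓞 K)) × Ideal (𝓞 K)} (h : t.2 ∉ t.1) :
    uIdeal t = ∏ P ∈ insert t.2 t.1, P := by
  classical
  rw [prod_insert h, uIdeal, mul_comm]

/-- The norm of `uIdeal t`: `N(P_1⋯P_{n+1}) = N(P_1⋯P_n) N(P_{n+1})`. [folklore] -/
theorem absNorm_uIdeal (t : Finset (Ideal (𝓞 K)) × Ideal (𝓞 K)) :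
    Ideal.absNorm (uIdeal t) = Ideal.absNorm (∏ P ∈ t.1, P) * Ideal.absNorm t.2 := by
  rw [uIdeal, map_mul]

/-- The norm of a product of ideals over a finite set is the product of the norms. [folklore] -/
theorem absNorm_prod (s : Finset (Ideal (𝓞 K))) :
    Ideal.absNorm (∏ P ∈ s, P) = ∏ P ∈ s, Ideal.absNorm P :=
  map_prod Ideal.absNorm _ s

/-- Finite sets of nonzero prime ideals with the same product coincide (unique factorisation).
[folklore] -/
theorem eq_of_prod_eq_prod {s s' : Finset (Ideal (𝓞 K))} (hs : ∀ P ∈ s, P.IsPrime ∧ P ≠ ⊥)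
    (hs' : ∀ P ∈ s', P.IsPrime ∧ P ≠ ⊥) (h : ∏ P ∈ s, P = ∏ P ∈ s', P) : s = s' := by
  -- one inclusion suffices by symmetry
  have key : ∀ {u u' : Finset (Ideal (𝓞 K))}, (∀ P ∈ u, P.IsPrime ∧ P ≠ ⊥) →
      (∀ P ∈ u', P.IsPrime ∧ P ≠ ⊥) → ∏ P ∈ u, P = ∏ P ∈ u', P → u ⊆ u' := by
    intro u u' hu hu' huu' P hP
    have hPp := (hu P hP).1
    have hle : ∏ Q ∈ u', Q ≤ P := by
      rw [← huu']
      exact Ideal.le_of_dvd (Finset.dvd_prod_of_mem _ hP)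
    obtain ⟨Q, hQ, hQP⟩ := (hPp.prod_le).mp hle
    have hQmax := (hu' Q hQ).1.isMaximal (hu' Q hQ).2
    have : Q = P := hQmax.eq_of_le hPp.ne_top hQP
    exact this ▸ hQ
  exact Subset.antisymm (key hs hs' h) (key hs' hs h.symm)

/-- **The re-indexing `(s, P_{n+1}) ↦ P_1⋯P_{n+1}` is injective on the indices of `U^(n)`**: the ideal
determines its set of prime factors `{P_1, …, P_{n+1}}`, whose `≺`-least member is `P_{n+1}`.
[cite: HeathBrownActa2001, §3 (3.1)] -/
theorem uIdeal_injOn (X τ : ℝ) (n : ℕ) : Set.InjOn uIdeal (Upairs X τ n : Set _) := by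
  classical
  intro t ht t' ht' h
  rw [Finset.mem_coe] at ht ht'
  have hmem := mem_Upairs_iff.mp ht
  have hmem' := mem_Upairs_iff.mp ht'
  have hprimes : ∀ {u : Finset (Ideal (𝓞 K)) × Ideal (𝓞 K)}, u ∈ Upairs X τ n →
      ∀ P ∈ insert u.2 u.1, P.IsPrime ∧ P ≠ ⊥ := by
    intro u hu P hP
    have hm := mem_Upairs_iff.mp hu
    rcases mem_insert.mp hP with rfl | hP
    · exact ⟨(mem_smallPrimes_iff.mp hm.2.1).1, (mem_smallPrimes_iff.mp hm.2.1).2.1⟩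
    · have h' := mem_smallPrimes_iff.mp ((mem_chains_iff.mp hm.1).1 hP)
      exact ⟨h'.1, h'.2.1⟩
  have hnot := snd_notMem_fst ht
  have hnot' := snd_notMem_fst ht'
  rw [uIdeal_eq_prod_insert hnot, uIdeal_eq_prod_insert hnot'] at h
  have hsets : insert t.2 t.1 = insert t'.2 t'.1 := eq_of_prod_eq_prod (hprimes ht) (hprimes ht') h
  have h2 : t.2 = t'.2 := by
    rw [← leastPrime_insert hmem.2.2.1, hsets, leastPrime_insert hmem'.2.2.1]
  have h1 : t.1 = t'.1 := by
    rw [← erase_insert hnot, hsets, h2, erase_insert hnot']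
  exact Prod.ext h1 h2

/-- An index `(s, P_{n+1})` is *good* if all of `P_1, …, P_{n+1}` have prime norm and their norms are
pairwise distinct — exactly when `N(P_1⋯P_{n+1})` is square-free (for `𝒜^(K)` every index with a
nonzero term is good, by Lemma 3.1). [cite: HeathBrownActa2001, Lemma 3.1] -/
def UGood (t : Finset (Ideal (𝓞 K)) × Ideal (𝓞 K)) : Prop :=
  (∀ P ∈ insert t.2 t.1, (Ideal.absNorm P).Prime) ∧
    Set.InjOn Ideal.absNorm ((insert t.2 t.1 : Finset (Ideal (𝓞 K))) : Set (Ideal (𝓞 K)))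

/-- For a good index, `N(P_1⋯P_{n+1})` is square-free (a product of distinct primes). [folklore] -/
theorem squarefree_absNorm_uIdeal {t : Finset (Ideal (𝓞 K)) × Ideal (𝓞 K)} (h2 : t.2 ∉ t.1)
    (hg : UGood t) : Squarefree (Ideal.absNorm (uIdeal t)) := by
  classical
  rw [uIdeal_eq_prod_insert h2, absNorm_prod]
  refine Finset.squarefree_prod_of_pairwise_isCoprime ?_ fun P hP => (Nat.prime_iff.mp (hg.1 P hP)).squarefree
  intro P hP P' hP' hne
  have hN : Ideal.absNorm P ≠ Ideal.absNorm P' := fun h => hne (hg.2 hP hP' h)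
  exact (Nat.coprime_iff_isRelPrime.mp ((Nat.coprime_primes (hg.1 P hP) (hg.1 P' hP')).mpr hN))

/-- **For `𝒜^(K)` only good indices contribute** (Lemma 3.1): if some `(x + y·2^{1/3})`, `(x, y) = 1`,
is divisible by `P_1⋯P_{n+1}`, then every `P_i` has prime norm and no two share a norm.
[cite: HeathBrownActa2001, Lemma 3.1] -/
theorem countA_uIdeal_eq_zero_of_not_good {X' η τ' X : ℝ} {n : ℕ}
    {t : Finset (Ideal (𝓞 K)) × Ideal (𝓞 K)} (ht : t ∈ Upairs X τ' n) (hg : ¬ UGood t) :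
    countA X' η (uIdeal t) = 0 := by
  classical
  have hmem := mem_Upairs_iff.mp ht
  have hprimes : ∀ P ∈ insert t.2 t.1, P.IsPrime ∧ P ≠ ⊥ := by
    intro P hP
    rcases mem_insert.mp hP with rfl | hP
    · exact ⟨(mem_smallPrimes_iff.mp hmem.2.1).1, (mem_smallPrimes_iff.mp hmem.2.1).2.1⟩
    · have h' := mem_smallPrimes_iff.mp ((mem_chains_iff.mp hmem.1).1 hP)
      exact ⟨h'.1, h'.2.1⟩
  have hdvd : ∀ P ∈ insert t.2 t.1, P ∣ uIdeal t := by
    intro P hP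
    rw [uIdeal_eq_prod_insert (snd_notMem_fst ht)]
    exact Finset.dvd_prod_of_mem _ hP
  rw [UGood, not_and_or] at hg
  rcases hg with h | h
  · push Not at h
    obtain ⟨P, hP, hnp⟩ := h
    exact countA_eq_zero_of_not_prime (hprimes P hP).1 (hprimes P hP).2 (hdvd P hP) hnp
  · rw [Set.InjOn] at h
    push Not at h
    obtain ⟨P, hP, P', hP', hN, hne⟩ := h
    rw [Finset.mem_coe] at hP hP'
    exact countA_eq_zero_of_absNorm_eq (hprimes P hP).1 (hprimes P hP).2 (hprimes P' hP').1 hne hN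
      (hdvd P hP) (hdvd P' hP')

open scoped Classical in
/-- **The good part of a `U`-piece via Lemma 7.1.** For a family `(E, I)`, a function `S ≥ 0` with
`S_K(𝒵_R, z) ≤ S(R)` satisfying the conclusion of Lemma 7.1 on dyadic blocks, and a set `T` of indices
of `U^(n)` with `z ≤ N(P_{n+1})` whose good members have `a ≤ N(P_1⋯P_{n+1}) < b`: the good part of
`∑_{t ∈ T} S_K^≺(𝒵_{P_1⋯P_{n+1}}, P_{n+1})` is at most
`C (M/log min(z, X^{2−τ}/b)) ∑_{t good} 1/N(P_1⋯P_{n+1}) + (log b/log 2 + 1) C·Err`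
(lower the level to `z`, re-index injectively by the ideal `P_1⋯P_{n+1}`, whose norm is square-free,
and sum Lemma 7.1 dyadically). This is the common shape of the treatment of `S₆`, `S₇` on p. 41.
[cite: HeathBrownActa2001, §7 p. 41] -/
theorem sum_good_le {ι : Type*} (E : Finset ι) (I : ι → Ideal (𝓞 K)) {X τ z C M Err a b : ℝ}
    {n : ℕ} {S : Ideal (𝓞 K) → ℝ} (hS0 : ∀ R, 0 ≤ S R) (hS : ∀ R, (famSifted E I R z : ℝ) ≤ S R)
    (h71 : ∀ (N : ℝ) (𝒬 : Finset ℕ), 0 < N → N ≤ X ^ (2 - 2 * τ) →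
        (∀ q ∈ 𝒬, Squarefree q ∧ N < q ∧ (q : ℝ) ≤ 2 * N) →
        ∑ Q ∈ normIn 𝒬, S Q ≤
          C * (M / Real.log (min z (X ^ (2 - τ) / N)) * ∑ q ∈ 𝒬, (q : ℝ)⁻¹ + Err))
    (hC : 0 ≤ C) (hM : 0 ≤ M) (hErr : 0 ≤ Err) (hX : 0 < X) (ha : 2 ≤ a) (hab : a ≤ b)
    (hb : b ≤ X ^ (2 - 2 * τ)) (hm : 1 < min z (X ^ (2 - τ) / b))
    (T : Finset (Finset (Ideal (𝓞 K)) × Ideal (𝓞 K))) (hT : T ⊆ Upairs X τ n)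
    (hz : ∀ t ∈ T, z ≤ Ideal.absNorm t.2)
    (hrange : ∀ t ∈ T, UGood t →
      a ≤ (Ideal.absNorm (uIdeal t) : ℝ) ∧ (Ideal.absNorm (uIdeal t) : ℝ) < b) :
    ∑ t ∈ T.filter UGood, (famSiftedAbove E I (uIdeal t) t.2 : ℝ) ≤
      C * (M / Real.log (min z (X ^ (2 - τ) / b)) *
          ∑ t ∈ T.filter UGood, ((Ideal.absNorm (uIdeal t) : ℕ) : ℝ)⁻¹) +
        (Real.log b / Real.log 2 + 1) * (C * Err) := by
  classical
  set Tg := T.filter UGood with hTg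
  have hTgU : ∀ t ∈ Tg, t ∈ Upairs X τ n := fun t ht => hT (mem_filter.mp ht).1
  -- Step 1: lower the level and pass to `S`
  have step1 : ∑ t ∈ Tg, (famSiftedAbove E I (uIdeal t) t.2 : ℝ) ≤ ∑ t ∈ Tg, S (uIdeal t) := by
    refine sum_le_sum fun t ht => ?_
    have ht' := (mem_filter.mp ht).1
    calc (famSiftedAbove E I (uIdeal t) t.2 : ℝ) ≤ famSifted E I (uIdeal t) z := by
          exact_mod_cast famSiftedAbove_le_famSifted E I _ _ (hz t ht')
      _ ≤ S (uIdeal t) := hS _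
  -- Step 2: re-index by the ideal (injective) and embed into `normIn 𝒬`
  set 𝒬 := Tg.image fun t => Ideal.absNorm (uIdeal t) with h𝒬def
  have hinj : Set.InjOn uIdeal (Tg : Set _) := (uIdeal_injOn X τ n).mono fun t ht => hTgU t ht
  have step2 : ∑ t ∈ Tg, S (uIdeal t) ≤ ∑ Q ∈ normIn 𝒬, S Q := by
    rw [← sum_image (g := uIdeal) (f := S) hinj]
    refine sum_le_sum_of_subset_of_nonneg ?_ fun Q _ _ => hS0 Q
    intro Q hQ
    obtain ⟨t, ht, rfl⟩ := mem_image.mp hQ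
    exact mem_normIn_iff.mpr (mem_image_of_mem _ ht)
  -- Step 3: Lemma 7.1 dyadically
  have h𝒬 : ∀ q ∈ 𝒬, Squarefree q ∧ a ≤ (q : ℝ) ∧ (q : ℝ) < b := by
    intro q hq
    obtain ⟨t, ht, rfl⟩ := mem_image.mp hq
    obtain ⟨htT, hg⟩ := mem_filter.mp ht
    exact ⟨squarefree_absNorm_uIdeal (snd_notMem_fst (hT htT)) hg, hrange t htT hg⟩
  have step3 := dyadic_sum_le h71 hC hM hErr hX ha hab hb hm 𝒬 h𝒬
  -- Step 4: `∑_{q ∈ 𝒬} 1/q ≤ ∑_{t good} 1/N(uIdeal t)`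
  have step4 : ∑ q ∈ 𝒬, (q : ℝ)⁻¹ ≤ ∑ t ∈ Tg, ((Ideal.absNorm (uIdeal t) : ℕ) : ℝ)⁻¹ :=
    sum_image_le_of_nonneg fun q _ => by positivity
  have hℓ : 0 < Real.log (min z (X ^ (2 - τ) / b)) := Real.log_pos hm
  calc ∑ t ∈ Tg, (famSiftedAbove E I (uIdeal t) t.2 : ℝ)
      ≤ ∑ Q ∈ normIn 𝒬, S Q := step1.trans step2
    _ ≤ C * (M / Real.log (min z (X ^ (2 - τ) / b)) * ∑ q ∈ 𝒬, (q : ℝ)⁻¹) +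
          (Real.log b / Real.log 2 + 1) * (C * Err) := step3
    _ ≤ C * (M / Real.log (min z (X ^ (2 - τ) / b)) *
            ∑ t ∈ Tg, ((Ideal.absNorm (uIdeal t) : ℕ) : ℝ)⁻¹) +
          (Real.log b / Real.log 2 + 1) * (C * Err) := by
        have : 0 ≤ M / Real.log (min z (X ^ (2 - τ) / b)) := div_nonneg hM hℓ.le
        gcongr

open scoped Classical in
/-- **For `𝒜^(K)` the non-good indices contribute nothing**: restricting a `U`-piece of `𝒜^(K)` to its
good indices does not change it. [cite: HeathBrownActa2001, Lemma 3.1] -/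
theorem sum_filter_UGood_boxPairs {X' η X τ : ℝ} {n : ℕ}
    (T : Finset (Finset (Ideal (𝓞 K)) × Ideal (𝓞 K))) (hT : T ⊆ Upairs X τ n) :
    ∑ t ∈ T.filter UGood, (famSiftedAbove (boxPairs X' η) pairIdeal (uIdeal t) t.2 : ℝ) =
      ∑ t ∈ T, (famSiftedAbove (boxPairs X' η) pairIdeal (uIdeal t) t.2 : ℝ) := by
  classical
  rw [sum_filter_of_ne]
  intro t ht hne
  by_contra hg
  have h0 : famSiftedAbove (boxPairs X' η) pairIdeal (uIdeal t) t.2 = 0 := by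
    have h := famSiftedAbove_le_famCount (boxPairs X' η) pairIdeal (uIdeal t) t.2
    rw [famCount_boxPairs, countA_uIdeal_eq_zero_of_not_good (hT ht) hg] at h
    exact Nat.le_zero.mp h
  exact hne (by rw [h0, Nat.cast_zero])

open scoped Classical in
/-- **For `ℬ^(K)` the non-good indices are bounded crudely**: the bad part of a `U`-piece of `ℬ^(K)`
is at most `C_ℬ X³ ∑_{t bad} 1/N(P_1⋯P_{n+1})` (`#ℬ^(K)_R ≤ C_ℬ X³/N(R)`).
[cite: HeathBrownActa2001, §7 pp. 41–42] -/
theorem sum_filter_not_UGood_normWindow_le {X η X' τ C_B : ℝ} {n : ℕ}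
    (hcountB : ∀ R : Ideal (𝓞 K), R ≠ ⊥ → (countB X η R : ℝ) ≤ C_B * X ^ 3 / Ideal.absNorm R)
    (T : Finset (Finset (Ideal (𝓞 K)) × Ideal (𝓞 K))) (hT : T ⊆ Upairs X' τ n) :
    ∑ t ∈ T.filter (fun t => ¬ UGood t),
        (famSiftedAbove (normWindow X η) (fun J => J) (uIdeal t) t.2 : ℝ) ≤
      C_B * X ^ 3 * ∑ t ∈ T.filter (fun t => ¬ UGood t), ((Ideal.absNorm (uIdeal t) : ℕ) : ℝ)⁻¹ := by
  classical
  rw [mul_sum]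
  refine sum_le_sum fun t ht => ?_
  have htU := hT (mem_filter.mp ht).1
  have hmem := mem_Upairs_iff.mp htU
  have h0 : uIdeal t ≠ ⊥ := by
    rw [uIdeal_eq_prod_insert (snd_notMem_fst htU)]
    intro h
    rw [← Ideal.zero_eq_bot, Finset.prod_eq_zero_iff] at h
    obtain ⟨P, hP, hP0⟩ := h
    rw [Ideal.zero_eq_bot] at hP0
    rcases mem_insert.mp hP with rfl | hP
    · exact (mem_smallPrimes_iff.mp hmem.2.1).2.1 hP0
    · exact (mem_smallPrimes_iff.mp ((mem_chains_iff.mp hmem.1).1 hP)).2.1 hP0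
  calc (famSiftedAbove (normWindow X η) (fun J => J) (uIdeal t) t.2 : ℝ)
      ≤ famCount (normWindow X η) (fun J => J) (uIdeal t) := by
        exact_mod_cast famSiftedAbove_le_famCount _ _ _ _
    _ = countB X η (uIdeal t) := by rw [famCount_normWindow]
    _ ≤ C_B * X ^ 3 / Ideal.absNorm (uIdeal t) := hcountB _ h0
    _ = C_B * X ^ 3 * ((Ideal.absNorm (uIdeal t) : ℕ) : ℝ)⁻¹ := by rw [div_eq_mul_inv]



/-! ### Reciprocal sums over prime ideals -/

/-- Fibrewise comparison: if every fibre of `f` on `s` has at most `n` elements and `g ≥ 0`, then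
`∑_{x ∈ s} g(f x) ≤ n ∑_{y ∈ f(s)} g(y)`. [folklore] -/
theorem sum_le_mul_sum_image_of_fiber_le {α β : Type*} [DecidableEq β] (s : Finset α) (f : α → β)
    {g : β → ℝ} (hg : ∀ y, 0 ≤ g y) (n : ℕ) (hn : ∀ y ∈ s.image f, #(s.filter fun x => f x = y) ≤ n) :
    ∑ x ∈ s, g (f x) ≤ n * ∑ y ∈ s.image f, g y := by
  classical
  rw [← sum_fiberwise_of_maps_to (g := f) (fun x hx => mem_image_of_mem f hx), mul_sum]
  refine sum_le_sum fun y hy => ?_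
  calc ∑ x ∈ s.filter (fun x => f x = y), g (f x) = ∑ x ∈ s.filter (fun x => f x = y), g y :=
        sum_congr rfl fun x hx => by rw [(mem_filter.mp hx).2]
    _ = #(s.filter fun x => f x = y) * g y := by rw [sum_const, nsmul_eq_mul]
    _ ≤ n * g y := mul_le_mul_of_nonneg_right (by exact_mod_cast hn y hy) (hg y)

/-- `∑ over A ∪ B ≤ ∑ over A + ∑ over B` for nonnegative summands. [folklore] -/
theorem sum_union_le_add {α : Type*} [DecidableEq α] (A B : Finset α) {f : α → ℝ}
    (hf : ∀ x, 0 ≤ f x) : ∑ x ∈ A ∪ B, f x ≤ ∑ x ∈ A, f x + ∑ x ∈ B, f x := by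
  rw [← sum_union_inter]
  have : 0 ≤ ∑ x ∈ A ∩ B, f x := sum_nonneg fun x _ => hf x
  linarith

/-- Sums over a filtered product as iterated sums. [folklore] -/
theorem sum_product_filter {α β : Type*} (A : Finset α) (B : Finset β) (p : α → β → Prop)
    [DecidablePred fun x : α × β => p x.1 x.2] [∀ a, DecidablePred (p a)] (g : α × β → ℝ) :
    ∑ x ∈ (A ×ˢ B).filter (fun x => p x.1 x.2), g x = ∑ a ∈ A, ∑ b ∈ B.filter (p a), g (a, b) := by
  rw [sum_filter, sum_product]
  refine sum_congr rfl fun a _ => ?_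
  rw [sum_filter]

/-- **`∑_{P} 1/N(P) ≤ 3(1 + log x)`** over any set of nonzero prime ideals of norm `≤ x` (`x ≥ 1`):
at most `3` prime ideals per norm, and the harmonic bound. [folklore] -/
theorem sum_inv_absNorm_le {x : ℝ} (hx : 1 ≤ x) (S : Finset (Ideal (𝓞 K)))
    (hS : ∀ P ∈ S, P.IsPrime ∧ P ≠ ⊥ ∧ (Ideal.absNorm P : ℝ) ≤ x) :
    ∑ P ∈ S, ((Ideal.absNorm P : ℕ) : ℝ)⁻¹ ≤ 3 * (1 + Real.log x) := by
  classical
  have h1 := sum_primes_le_three_mul_sum_image S (fun P hP => ⟨(hS P hP).1, (hS P hP).2.1⟩)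
    (g := fun n : ℕ => (n : ℝ)⁻¹) (fun n => by positivity)
  refine h1.trans (mul_le_mul_of_nonneg_left ?_ (by norm_num))
  refine sum_inv_le_one_add_log hx _ fun n hn => ?_
  obtain ⟨P, hP, rfl⟩ := mem_image.mp hn
  refine ⟨Nat.one_le_iff_ne_zero.mpr fun h => (hS P hP).2.1 (Ideal.absNorm_eq_zero_iff.mp h), (hS P hP).2.2⟩

/-- At most `3` nonzero prime ideals of `𝓞_K` in a set have norm with a given least prime factor `q`
(they all lie over `q`). [folklore] -/
theorem card_filter_minFac_absNorm_eq_le_three (S : Finset (Ideal (𝓞 K)))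
    (hS : ∀ P ∈ S, P.IsPrime ∧ P ≠ ⊥) (q : ℕ) :
    #(S.filter fun P => (Ideal.absNorm P).minFac = q) ≤ 3 := by
  classical
  set T := S.filter fun P => (Ideal.absNorm P).minFac = q with hT
  by_cases hne : T.Nonempty
  · obtain ⟨P₀, hP₀⟩ := hne
    obtain ⟨hP₀S, hP₀q⟩ := mem_filter.mp hP₀
    obtain ⟨q₀, f₀, hq₀, hf₀, -, hN₀, -⟩ := exists_absNorm_eq_prime_pow_le_three (hS P₀ hP₀S).1 (hS P₀ hP₀S).2
    have hqq₀ : q = q₀ := by rw [← hP₀q, hN₀, hq₀.pow_minFac (by omega)]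
    have hq : q.Prime := hqq₀ ▸ hq₀
    have hsub : ((T : Finset (Ideal (𝓞 K))) : Set (Ideal (𝓞 K))) ⊆
        (Ideal.span {(q : ℤ)}).primesOver (𝓞 K) := by
      intro P hP
      rw [Finset.mem_coe] at hP
      obtain ⟨hPS, hPq⟩ := mem_filter.mp hP
      obtain ⟨q', f', hq', hf', -, hN', hover'⟩ :=
        exists_absNorm_eq_prime_pow_le_three (hS P hPS).1 (hS P hPS).2
      have : q' = q := by rw [← hPq, hN', hq'.pow_minFac (by omega)]
      subst this
      exact hover'
    haveI := Fact.mk hq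
    haveI : (Ideal.span {(q : ℤ)}).IsMaximal := Int.ideal_span_isMaximal_of_prime q
    have hfin : ((Ideal.span {(q : ℤ)}).primesOver (𝓞 K)).Finite :=
      IsDedekindDomain.primesOver_finite _ _
    calc #T = ((T : Finset (Ideal (𝓞 K))) : Set (Ideal (𝓞 K))).ncard := by rw [Set.ncard_coe_finset]
      _ ≤ ((Ideal.span {(q : ℤ)}).primesOver (𝓞 K)).ncard := Set.ncard_le_ncard hsub hfin
      _ = Nat.card ((Ideal.span {(q : ℤ)}).primesOver (𝓞 K)) := (Nat.card_coe_set_eq _).symm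
      _ ≤ Module.finrank ℚ K := Literature.NumberTheory.LFunctions.IdealNormCount.card_primesOver_le K hq
      _ = 3 := finrank_K
  · rw [not_nonempty_iff_eq_empty.mp hne, card_empty]
    exact Nat.zero_le _

/-- **Prime ideals of non-prime norm are sparse in reciprocal sum**: over any set of nonzero prime
ideals `P` with `N(P)` not prime and `N(P) > Y ≥ 8`, `∑ 1/N(P) ≤ 6/Y^{1/3}` (`N(P) = q^f` with
`2 ≤ f ≤ 3`, so `1/N(P) ≤ 1/q²` with `q > Y^{1/3}`, at most `3` ideals per `q`). This is the
mechanism behind "prime ideals of degree greater than 1 … contribute `O(X^{11/4})`" (pp. 41–42).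
[cite: HeathBrownActa2001, §7 pp. 41–42] -/
theorem sum_inv_absNorm_nonprime_le {Y : ℝ} (hY : 8 ≤ Y) (S : Finset (Ideal (𝓞 K)))
    (hS : ∀ P ∈ S, P.IsPrime ∧ P ≠ ⊥ ∧ ¬ (Ideal.absNorm P).Prime ∧ Y < (Ideal.absNorm P : ℝ)) :
    ∑ P ∈ S, ((Ideal.absNorm P : ℕ) : ℝ)⁻¹ ≤ 6 / Y ^ (1 / 3 : ℝ) := by
  classical
  have hY0 : 0 < Y := by linarith
  have hY3 : 2 ≤ Y ^ (1 / 3 : ℝ) := by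
    calc (2 : ℝ) = (8 : ℝ) ^ (1 / 3 : ℝ) := by
          rw [show (8 : ℝ) = 2 ^ (3 : ℝ) by norm_num, ← Real.rpow_mul (by norm_num)]; norm_num
      _ ≤ Y ^ (1 / 3 : ℝ) := Real.rpow_le_rpow (by norm_num) hY (by norm_num)
  -- structure of the norms
  have key : ∀ P ∈ S, ∃ q f : ℕ, q.Prime ∧ 2 ≤ f ∧ f ≤ 3 ∧ Ideal.absNorm P = q ^ f ∧
      (Ideal.absNorm P).minFac = q ∧ Y ^ (1 / 3 : ℝ) < q := by
    intro P hP
    obtain ⟨hPp, hP0, hnp, hYP⟩ := hS P hP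
    obtain ⟨q, f, hq, hf, hf3, hN, -⟩ := exists_absNorm_eq_prime_pow_le_three hPp hP0
    have hf2 : 2 ≤ f := by
      by_contra h
      have h1 : f = 1 := by omega
      rw [h1, pow_one] at hN
      exact hnp (hN ▸ hq)
    refine ⟨q, f, hq, hf2, hf3, hN, by rw [hN, hq.pow_minFac (by omega)], ?_⟩
    -- `q³ ≥ q^f = N P > Y`
    have hq1 : 1 ≤ q := hq.one_lt.le
    have hq3 : Y < (q : ℝ) ^ 3 := by
      calc Y < (Ideal.absNorm P : ℝ) := hYP
        _ = (q : ℝ) ^ f := by rw [hN]; push_cast; ring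
        _ ≤ (q : ℝ) ^ 3 := pow_le_pow_right₀ (by exact_mod_cast hq1) hf3
    by_contra hle
    push Not at hle
    have : (q : ℝ) ^ 3 ≤ Y := by
      calc (q : ℝ) ^ 3 ≤ (Y ^ (1 / 3 : ℝ)) ^ 3 := by gcongr
        _ = Y := by rw [← Real.rpow_natCast, ← Real.rpow_mul hY0.le]; norm_num
    linarith
  -- pointwise `1/N(P) ≤ 1/q²`
  have hpt : ∀ P ∈ S, ((Ideal.absNorm P : ℕ) : ℝ)⁻¹ ≤ (((Ideal.absNorm P).minFac : ℝ) ^ 2)⁻¹ := by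
    intro P hP
    obtain ⟨q, f, hq, hf2, -, hN, hmin, -⟩ := key P hP
    rw [hmin, hN]
    have hq0 : (0 : ℝ) < q := by exact_mod_cast hq.pos
    refine inv_anti₀ (by positivity) ?_
    calc (q : ℝ) ^ 2 ≤ (q : ℝ) ^ f := pow_le_pow_right₀ (by exact_mod_cast hq.one_lt.le) hf2
      _ = ((q ^ f : ℕ) : ℝ) := by push_cast; ring
  calc ∑ P ∈ S, ((Ideal.absNorm P : ℕ) : ℝ)⁻¹
      ≤ ∑ P ∈ S, (((Ideal.absNorm P).minFac : ℝ) ^ 2)⁻¹ := sum_le_sum hpt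
    _ ≤ 3 * ∑ q ∈ S.image (fun P => (Ideal.absNorm P).minFac), ((q : ℝ) ^ 2)⁻¹ := by
        refine sum_le_mul_sum_image_of_fiber_le S (fun P => (Ideal.absNorm P).minFac)
          (g := fun q : ℕ => ((q : ℝ) ^ 2)⁻¹) (fun q => by positivity) 3 fun q _ => ?_
        exact card_filter_minFac_absNorm_eq_le_three S (fun P hP => ⟨(hS P hP).1, (hS P hP).2.1⟩) q
    _ ≤ 3 * (2 / Y ^ (1 / 3 : ℝ)) := by
        refine mul_le_mul_of_nonneg_left (sum_inv_sq_tail_le hY3 _ fun q hq => ?_) (by norm_num)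
        obtain ⟨P, hP, rfl⟩ := mem_image.mp hq
        obtain ⟨q, f, -, -, -, -, hmin, hYq⟩ := key P hP
        rw [hmin]
        exact hYq
    _ = 6 / Y ^ (1 / 3 : ℝ) := by ring

/-- **Pairs of prime ideals with equal prime norm are sparse**: over any set `D` of pairs `(P, P')` of
nonzero prime ideals with `N(P) = N(P') > Y ≥ 2`,
`∑ 1/(N(P)N(P')) ≤ 18/Y` (at most `9` pairs per norm, and `∑_{n > Y} 1/n² ≤ 2/Y`).
[cite: HeathBrownActa2001, §7 pp. 41–42] -/
theorem sum_inv_absNorm_pair_eq_le {Y : ℝ} (hY : 2 ≤ Y) (D : Finset (Ideal (𝓞 K) × Ideal (𝓞 K)))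
    (hD : ∀ x ∈ D, x.1.IsPrime ∧ x.1 ≠ ⊥ ∧ x.2.IsPrime ∧ x.2 ≠ ⊥ ∧
      Ideal.absNorm x.1 = Ideal.absNorm x.2 ∧ Y < (Ideal.absNorm x.1 : ℝ)) :
    ∑ x ∈ D, ((Ideal.absNorm x.1 : ℕ) : ℝ)⁻¹ * ((Ideal.absNorm x.2 : ℕ) : ℝ)⁻¹ ≤ 18 / Y := by
  classical
  have heq : ∀ x ∈ D, ((Ideal.absNorm x.1 : ℕ) : ℝ)⁻¹ * ((Ideal.absNorm x.2 : ℕ) : ℝ)⁻¹ =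
      (((Ideal.absNorm x.1 : ℕ) : ℝ) ^ 2)⁻¹ := by
    intro x hx
    rw [← (hD x hx).2.2.2.2.1, sq, mul_inv]
  rw [sum_congr rfl heq]
  -- fibres of `x ↦ N(x.1)` have at most `9` elements
  have hfib : ∀ n ∈ D.image (fun x => Ideal.absNorm x.1),
      #(D.filter fun x => Ideal.absNorm x.1 = n) ≤ 9 := by
    intro n _
    set A := (D.image Prod.fst ∪ D.image Prod.snd).filter
      fun P => P.IsPrime ∧ P ≠ ⊥ ∧ Ideal.absNorm P = n with hA
    have hA3 : #A ≤ 3 := card_filter_isPrime_absNorm_eq_le_three _ n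
    have hsub : D.filter (fun x => Ideal.absNorm x.1 = n) ⊆ A ×ˢ A := by
      intro x hx
      obtain ⟨hxD, hxn⟩ := mem_filter.mp hx
      obtain ⟨h1, h2, h3, h4, h5, -⟩ := hD x hxD
      rw [mem_product, hA, mem_filter, mem_filter]
      exact ⟨⟨mem_union_left _ (mem_image_of_mem _ hxD), h1, h2, hxn⟩,
        ⟨mem_union_right _ (mem_image_of_mem _ hxD), h3, h4, h5 ▸ hxn⟩⟩
    calc #(D.filter fun x => Ideal.absNorm x.1 = n) ≤ #(A ×ˢ A) := card_le_card hsub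
      _ = #A * #A := card_product _ _
      _ ≤ 3 * 3 := Nat.mul_le_mul hA3 hA3
  calc ∑ x ∈ D, (((Ideal.absNorm x.1 : ℕ) : ℝ) ^ 2)⁻¹
      ≤ 9 * ∑ n ∈ D.image (fun x => Ideal.absNorm x.1), ((n : ℝ) ^ 2)⁻¹ :=
        sum_le_mul_sum_image_of_fiber_le D (fun x => Ideal.absNorm x.1)
          (g := fun n : ℕ => ((n : ℝ) ^ 2)⁻¹) (fun n => by positivity) 9 hfib
    _ ≤ 9 * (2 / Y) := by
        refine mul_le_mul_of_nonneg_left (sum_inv_sq_tail_le hY _ fun n hn => ?_) (by norm_num)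
        obtain ⟨x, hx, rfl⟩ := mem_image.mp hn
        exact (hD x hx).2.2.2.2.2
    _ = 18 / Y := by ring

/-- **Windows of first-degree prime ideals**: over any set of nonzero prime ideals `P` of prime norm
with `lo < N(P) ≤ hi` (`2 ≤ lo ≤ hi`), `∑ 1/N(P) ≤ 3 (log(hi/lo) + K₁)/log lo`.
[cite: HeathBrownActa2001, §7 (7.1)–(7.2)] -/
theorem sum_inv_absNorm_window_le {K₁ : ℝ}
    (hK : ∀ (lo hi : ℝ) (T : Finset ℕ), 2 ≤ lo → lo ≤ hi →
      (∀ p ∈ T, p.Prime ∧ lo < (p : ℝ) ∧ (p : ℝ) ≤ hi) →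
      ∑ p ∈ T, (p : ℝ)⁻¹ ≤ (Real.log (hi / lo) + K₁) / Real.log lo)
    {lo hi : ℝ} (hlo : 2 ≤ lo) (hlohi : lo ≤ hi) (S : Finset (Ideal (𝓞 K)))
    (hS : ∀ P ∈ S, P.IsPrime ∧ P ≠ ⊥ ∧ (Ideal.absNorm P).Prime ∧
      lo < (Ideal.absNorm P : ℝ) ∧ (Ideal.absNorm P : ℝ) ≤ hi) :
    ∑ P ∈ S, ((Ideal.absNorm P : ℕ) : ℝ)⁻¹ ≤ 3 * ((Real.log (hi / lo) + K₁) / Real.log lo) := by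
  classical
  have h1 := sum_primes_le_three_mul_sum_image S (fun P hP => ⟨(hS P hP).1, (hS P hP).2.1⟩)
    (g := fun n : ℕ => (n : ℝ)⁻¹) (fun n => by positivity)
  refine h1.trans (mul_le_mul_of_nonneg_left ?_ (by norm_num))
  refine hK lo hi _ hlo hlohi fun p hp => ?_
  obtain ⟨P, hP, rfl⟩ := mem_image.mp hp
  exact ⟨(hS P hP).2.2.1, (hS P hP).2.2.2.1, (hS P hP).2.2.2.2⟩


end Literature.NumberTheory.Sieve.CubicSieve

end
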